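import Literature.Analysis.FluidPDE.DEIJCriterion
import Literature.Analysis.FluidPDE.ShearCascadeDrifts
import Literature.Analysis.FunctionSpaces.TorusDiffMonomialBounds
import HarnessLib

/-!
# Transversal shear stages on `T^d`: volume preservation, drifts, transport, the growth of first
# and second derivatives under one shear, and smoothed sawtooth profiles

Infrastructure for the alternating-shear construction of Drivas–Elgindi–Iyer–Jeong
[cite: DrivasEtAl2022, §3] in general dimension `d` (displaced coordinate `p`, driving coordinate
`q ≠ p`), used to discharge `deij_anomalous_dissipation_eventually` through the balanced-growth
criterion `Torus.DEIJ.le_eScalarDissipation_of_balanced_growth` (`DEIJCriterion`).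

* `DEIJ.measurePreserving_shearMap_pi`: the transversal shear `x ↦ x - φ(x_q)e_p` of
  `FunctionSpaces.Torus.shearMap` preserves the Haar measure of `T^d` for every finite index type
  (the tree had the planar case); `DEIJ.integral_comp_shearMap'`.
* `DEIJ.drift p q φ b = (b φ(x_q)) e_p`, smooth and divergence free, `‖drift‖ ≤ |b| sup|φ|`;
  `DEIJ.moved G p q φ a t = G t ∘ shear_{a(t)φ}` and the exact transport identity
  `∂_t (Θ ∘ shear_{a(t)φ}) + ⟨drift (ȧ(t)), ∇(Θ ∘ shear_{a(t)φ})⟩ = 0`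
  (`DEIJ.transport_moved_static`) [cite: DrivasEtAl2022, §2.1, eq. (2.1)–(2.3)].
* First derivatives after a shear (`DEIJ.partialDeriv_comp_shearMap`):
  `∂_r(g∘Φ) = (∂_r g)∘Φ - δ_{rq} φ'(x_q) (∂_p g)∘Φ`, and the resulting `L²` identities
  `‖∂_r(g∘Φ)‖² = ‖∂_r g‖²` (`r ≠ q`),
  `‖∂_q(g∘Φ)‖² = ‖∂_q g‖² - 2∫φ'(x_q)∂_q g ∂_p g + ∫φ'(x_q)²(∂_p g)²`
  [cite: DrivasEtAl2022, Lemma 3.2 and its proof, p. 11].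
* The Hessian `DEIJ.hess g x` (second derivative of the lift), `(Δg)² ≤ (card d)²‖hess g‖²`, and
  the second-order chain rule estimate
  `‖hess(g∘Φ)‖_{L²} ≤ (1 + sup|φ'|)² ‖hess g‖_{L²} + ‖φ''(x_q) ∇g‖_{L²}`
  (`DEIJ.sqrt_integral_hess_comp_shearMap_le`) [cite: DrivasEtAl2022, Lemma 3.4, p. 13].
* Smoothed sawtooth profiles: the slope wave `DEIJ.slopeWave ε` (`= ±1` off two windows of
  length `2ε` per period, `|w| ≤ 1`, zero mean, `∫₀¹(1 - w²) ≤ 4ε`, `∫₀¹ (w')² ≤ 16C_ψ²/ε`), its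
  primitive `DEIJ.sawS ε` (smooth, `1`-periodic, `|S| ≤ 1`) and the stage profile
  `DEIJ.stageProfile ε _ _ N c ϑ = (y ↦ c S_ε(N y + ϑ))` as a `ShearProfile`, with
  `|profile'| ≤ |c| N`, `|profile''| ≤ |c| N² 2C_ψ/ε` (the "sawtooth with mollified corners" of
  [cite: DrivasEtAl2022, §3.1, p. 10], made quantitative).

## References

* [DrivasEtAl2022] T. D. Drivas, T. M. Elgindi, G. Iyer, I.-J. Jeong, *Anomalous dissipation in
  passive scalar transport*, Arch. Ration. Mech. Anal. 243 (2022), 1151–1180, arXiv:1911.03271, §2.1,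
  §3.1–3.3.
-/

noncomputable section

open MeasureTheory TopologicalSpace Set Function Filter Topology UnitAddTorus
open scoped ENNReal NNReal InnerProductSpace ContDiff
open Literature.Analysis.FunctionSpaces.Torus
-- the coordinate partial derivative on the torus (`FunctionSpaces.Torus.partialDeriv`) is shadowed in
-- the namespace `Literature.Analysis.FluidPDE` by the Euclidean one; give it a local name
open Literature.Analysis.FunctionSpaces.Torus renaming partialDeriv → tPartialDeriv

namespace Literature.Analysis.FluidPDE

namespace Torus

namespace DEIJ

variable {d : Type*} [Fintype d] [DecidableEq d]

/-! ## The transversal shear preserves the volume of `T^d` -/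

section Volume

/-- **The transversal shear preserves the volume of `T^d`.** In the coordinates
`T^d ≃ T^{d ∖ {p}} × T^{{p}}` the shear along `e_p` driven by `x_q` is a translation of the second
factor by an amount depending on the first only; such skew translations preserve the product of
the Haar measures (general-dimensional version of the planar
`FunctionSpaces.Torus.measurePreserving_shearMap`). [folklore] -/
theorem measurePreserving_shearMap_pi {p q : d} (hpq : p ≠ q) (P : ShearProfile) :
    MeasurePreserving (shearMap p q P) (volume : Measure (UnitAddTorus d)) volume := by
  classical
  have hqp : q ≠ p := fun h => hpq h.symm
  set c : UnitAddCircle → UnitAddCircle := fun b => ((P.onCircle b : ℝ) : UnitAddCircle) with hc_def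
  have hc : Measurable c := (AddCircle.continuous_mk' (1 : ℝ)).measurable.comp P.measurable_onCircle
  -- product coordinates `x ↦ ((x_l)_{l ≠ p}, (x_l)_{l = p})`
  have he := volume_preserving_piEquivPiSubtypeProd (fun _ : d => UnitAddCircle) (fun l => l ≠ p)
  set e := MeasurableEquiv.piEquivPiSubtypeProd (fun _ : d => UnitAddCircle) (fun l => l ≠ p) with he_def
  -- the skew translation in product coordinates
  set v : ({l : d // l ≠ p} → UnitAddCircle) → ({l : d // ¬ l ≠ p} → UnitAddCircle) :=
    fun b _ => c (b ⟨q, hqp⟩) with hv_def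
  have hvm : Measurable v := measurable_pi_lambda _ fun _ => hc.comp (measurable_pi_apply _)
  have hΨ : MeasurePreserving
      (fun z : ({l : d // l ≠ p} → UnitAddCircle) × ({l : d // ¬ l ≠ p} → UnitAddCircle) => (z.1, z.2 - v z.1))
      ((volume : Measure ({l : d // l ≠ p} → UnitAddCircle)).prod (volume : Measure ({l : d // ¬ l ≠ p} → UnitAddCircle)))
      ((volume : Measure ({l : d // l ≠ p} → UnitAddCircle)).prod (volume : Measure ({l : d // ¬ l ≠ p} → UnitAddCircle))) := by
    refine (MeasurePreserving.id volume).skew_product (g := fun b a => a - v b)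
      (measurable_snd.sub (hvm.comp measurable_fst)) (Eventually.of_forall fun b => ?_)
    exact (measurePreserving_sub_right volume (v b)).map_eq
  -- intertwining
  have hinter : shearMap p q P =
      e.symm ∘ (fun z : ({l : d // l ≠ p} → UnitAddCircle) × ({l : d // ¬ l ≠ p} → UnitAddCircle) =>
        (z.1, z.2 - v z.1)) ∘ e := by
    funext x
    ext l
    simp only [Function.comp_apply, he_def, MeasurableEquiv.piEquivPiSubtypeProd_symm_apply,
      MeasurableEquiv.piEquivPiSubtypeProd_apply]
    by_cases hl : l = p
    · subst hl
      simp [shearMap_apply, hv_def, hc_def]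
    · simp [hl, shearMap_apply_of_ne P x hl]
  rw [hinter]
  exact he.symm.comp (hΨ.comp he)

/-- **Change of variables**: `∫ f ∘ shear = ∫ f` on `T^d`. [folklore] -/
theorem integral_comp_shearMap' {E : Type*} [NormedAddCommGroup E] [NormedSpace ℝ E]
    {p q : d} (hpq : p ≠ q) (P : ShearProfile) (f : UnitAddTorus d → E) :
    ∫ x, f (shearMap p q P x) = ∫ x, f x := by
  have h : MeasurePreserving (shearEquiv hpq P) volume volume := measurePreserving_shearMap_pi hpq P
  exact h.integral_comp' f

end Volume

/-! ## Shear drifts on `T^d` and the transport of a profile by a moving shear -/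

section Drift

/-- **The shear drift** `x ↦ (b φ(x_q)) e_p` on `T^d` (the Eulerian velocity of the moving shear
`x ↦ x - a(t)φ(x_q)e_p` is this field with `b = ȧ(t)`; general-dimensional version of
`ShearStage.drift`). [folklore] -/
def drift (p q : d) (P : ShearProfile) (b : ℝ) (x : UnitAddTorus d) : EuclideanSpace ℝ d :=
  (b * P.onCircle (x q)) • EuclideanSpace.single p (1 : ℝ)

omit [Fintype d] in
/-- Unfolding the drift. [folklore] -/
theorem drift_apply (p q : d) (P : ShearProfile) (b : ℝ) (x : UnitAddTorus d) :
    drift p q P b x = (b * P.onCircle (x q)) • EuclideanSpace.single p (1 : ℝ) := rfl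

omit [Fintype d] in
/-- The drift with `b = 0` vanishes. [folklore] -/
@[simp]
theorem drift_zero (p q : d) (P : ShearProfile) : drift p q P 0 = 0 := by
  funext x; simp [drift_apply]

omit [DecidableEq d] in
/-- The scalar factor `x ↦ φ(x_q)` is smooth on the torus. [folklore] -/
theorem isSmooth_onCircle_comp (q : d) (P : ShearProfile) :
    IsSmooth fun x : UnitAddTorus d => P.onCircle (x q) := by
  unfold IsSmooth lift
  have : (fun y : EuclideanSpace ℝ d => P.onCircle (proj y q)) = fun y => P (y q) := by
    funext y; rw [proj_apply, ShearProfile.onCircle_coe]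
  simp only [Function.comp_def]
  rw [this]
  exact P.contDiff.comp (EuclideanSpace.proj q : EuclideanSpace ℝ d →L[ℝ] ℝ).contDiff

/-- The drift is smooth. [folklore] -/
theorem isSmooth_drift (p q : d) (P : ShearProfile) (b : ℝ) : IsSmooth (drift p q P b) := by
  have h : IsSmooth fun x : UnitAddTorus d => b * P.onCircle (x q) := IsSmooth.smul b (isSmooth_onCircle_comp q P)
  exact h.smul' (isSmooth_const _)

/-- **The drift is divergence free** (`p ≠ q`: its only nonzero component, the `p`-th, does not
depend on `x_p`). [folklore] -/
theorem isDivFree_drift {p q : d} (hpq : p ≠ q) (P : ShearProfile) (b : ℝ) : IsDivFree (drift p q P b) := by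
  intro x
  unfold FunctionSpaces.Torus.divergence FunctionSpaces.Torus.partialDeriv FunctionSpaces.Torus.lineDeriv
  refine Finset.sum_eq_zero fun l _ => ?_
  have : (fun t : ℝ => drift p q P b (x + proj (t • EuclideanSpace.single l (1 : ℝ))) l) = fun _ => drift p q P b x l := by
    funext t
    by_cases hl : l = p
    · subst hl
      simp [drift_apply, proj_apply, Pi.add_apply, hpq.symm]
    · simp [drift_apply, hl]
  rw [this, deriv_const]

/-- `‖drift x‖ = |b| |φ(x_q)|`. [folklore] -/
theorem norm_drift (p q : d) (P : ShearProfile) (b : ℝ) (x : UnitAddTorus d) :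
    ‖drift p q P b x‖ = |b| * |P.onCircle (x q)| := by
  rw [drift_apply, norm_smul, PiLp.norm_single, norm_one, mul_one, Real.norm_eq_abs, abs_mul]

/-- **Uniform bound of the drift**: `‖drift b x‖ ≤ |b| M` when `|φ| ≤ M`. [folklore] -/
theorem norm_drift_le (p q : d) {P : ShearProfile} {M : ℝ} (hM : ∀ t, |P t| ≤ M) (b : ℝ) (x : UnitAddTorus d) :
    ‖drift p q P b x‖ ≤ |b| * M := by
  rw [norm_drift]
  refine mul_le_mul_of_nonneg_left ?_ (abs_nonneg _)
  induction x q using QuotientAddGroup.induction_on with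
  | H t => rw [ShearProfile.onCircle_coe]; exact hM t

omit [DecidableEq d] in
/-- A smooth function of time alone is a jointly smooth space–time field. [folklore] -/
theorem isSmoothSpaceTimeOn_time {c : ℝ → ℝ} (hc : ContDiff ℝ ∞ c) (S : Set ℝ) :
    FunctionSpaces.Torus.IsSmoothSpaceTimeOn S (fun t (_ : UnitAddTorus d) => c t) := by
  refine FunctionSpaces.Torus.isSmoothSpaceTimeOn_of_contDiff ?_ S
  have : FunctionSpaces.Torus.stLift (fun t (_ : UnitAddTorus d) => c t) = c ∘ Prod.fst := by funext z; rfl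
  rw [this]; exact hc.comp contDiff_fst

/-- **The time-dependent drift** `(t, x) ↦ (b(t) φ(x_q)) e_p` is jointly smooth for smooth `b`. [folklore] -/
theorem isSmoothSpaceTimeOn_drift (p q : d) (P : ShearProfile) {b : ℝ → ℝ} (hb : ContDiff ℝ ∞ b) (S : Set ℝ) :
    FunctionSpaces.Torus.IsSmoothSpaceTimeOn S (fun t => drift p q P (b t)) := by
  have h : (fun t => drift p q P (b t)) = fun t (x : UnitAddTorus d) => b t • drift p q P 1 x := by
    funext t x; simp [drift_apply, smul_smul]
  rw [h]
  exact (isSmoothSpaceTimeOn_time hb S).smul (FunctionSpaces.Torus.isSmoothSpaceTimeOn_const (isSmooth_drift p q P 1) S)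

variable {G' : Type*} [NormedAddCommGroup G'] [NormedSpace ℝ G']

/-- **A space–time field composed with a moving shear**: `(t, x) ↦ G(t, x - a(t)φ(x_q)e_p)`. [folklore] -/
def moved (G : ℝ → UnitAddTorus d → G') (p q : d) (P : ShearProfile) (a : ℝ → ℝ) (t : ℝ) (x : UnitAddTorus d) : G' :=
  G t (shearMap p q (ShearStage.amp P (a t)) x)

omit [NormedAddCommGroup G'] [NormedSpace ℝ G'] in
omit [Fintype d] in
/-- Unfolding `moved`. [folklore] -/
theorem moved_apply (G : ℝ → UnitAddTorus d → G') (p q : d) (P : ShearProfile) (a : ℝ → ℝ) (t : ℝ) (x : UnitAddTorus d) :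
    moved G p q P a t x = G t (shearMap p q (ShearStage.amp P (a t)) x) := rfl

/-- The planar lift of the moving shear, as a map of space–time. [folklore] -/
def movedLift (p q : d) (P : ShearProfile) (a : ℝ → ℝ) (z : ℝ × EuclideanSpace ℝ d) : ℝ × EuclideanSpace ℝ d :=
  (z.1, shearMapLift p q (ShearStage.amp P (a z.1)) z.2)

/-- The space–time lift of the moving shear is smooth. [folklore] -/
theorem contDiff_movedLift (p q : d) (P : ShearProfile) {a : ℝ → ℝ} (ha : ContDiff ℝ ∞ a) :
    ContDiff ℝ ∞ (movedLift p q P a) := by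
  unfold movedLift shearMapLift
  refine contDiff_fst.prodMk ?_
  simp only [ShearStage.amp_apply]
  have h : ContDiff ℝ ∞ fun z : ℝ × EuclideanSpace ℝ d => a z.1 * P (z.2 q) :=
    (ha.comp contDiff_fst).mul (P.contDiff.comp ((EuclideanSpace.proj q : EuclideanSpace ℝ d →L[ℝ] ℝ).contDiff.comp contDiff_snd))
  exact contDiff_snd.sub (h.smul contDiff_const)

omit [NormedAddCommGroup G'] [NormedSpace ℝ G'] in
omit [Fintype d] in
/-- `stLift (moved G) = stLift G ∘ movedLift`. [folklore] -/
theorem stLift_moved (G : ℝ → UnitAddTorus d → G') (p q : d) (P : ShearProfile) (a : ℝ → ℝ) :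
    FunctionSpaces.Torus.stLift (moved G p q P a) = FunctionSpaces.Torus.stLift G ∘ movedLift p q P a := by
  funext z
  obtain ⟨t, y⟩ := z
  simp only [FunctionSpaces.Torus.stLift_apply, Function.comp_apply, movedLift, moved_apply, shearMap_proj]

/-- **Composition with a moving shear preserves joint smoothness** (on the whole time axis). [folklore] -/
theorem isSmoothSpaceTimeOn_moved {G : ℝ → UnitAddTorus d → G'} (hG : FunctionSpaces.Torus.IsSmoothSpaceTimeOn univ G) (p q : d)
    (P : ShearProfile) {a : ℝ → ℝ} (ha : ContDiff ℝ ∞ a) :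
    FunctionSpaces.Torus.IsSmoothSpaceTimeOn univ (moved G p q P a) := by
  unfold FunctionSpaces.Torus.IsSmoothSpaceTimeOn
  rw [stLift_moved, Set.univ_prod_univ]
  have hG' : ContDiff ℝ ∞ (FunctionSpaces.Torus.stLift G) := by
    have := hG; unfold FunctionSpaces.Torus.IsSmoothSpaceTimeOn at this; rwa [Set.univ_prod_univ, contDiffOn_univ] at this
  exact (hG'.comp (contDiff_movedLift p q P ha)).contDiffOn

variable {p q : d}

/-- **The derivative of the shear lift**: `D(y ↦ y - φ(y_q)e_p)(y) = id - φ'(y_q) (π_q ⊗ e_p)`. [folklore] -/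
theorem hasFDerivAt_shearMapLift (P : ShearProfile) (y : EuclideanSpace ℝ d) :
    HasFDerivAt (shearMapLift p q P)
      (ContinuousLinearMap.id ℝ (EuclideanSpace ℝ d) -
        (deriv P (y q) • (EuclideanSpace.proj q : EuclideanSpace ℝ d →L[ℝ] ℝ)).smulRight
          (EuclideanSpace.single p (1 : ℝ))) y := by
  have h1 : HasFDerivAt (fun y : EuclideanSpace ℝ d => y q) (EuclideanSpace.proj q : EuclideanSpace ℝ d →L[ℝ] ℝ) y :=
    (EuclideanSpace.proj q : EuclideanSpace ℝ d →L[ℝ] ℝ).hasFDerivAt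
  have h2 : HasDerivAt P (deriv P (y q)) (y q) := (P.contDiff.differentiable (by simp)).differentiableAt.hasDerivAt
  have hφ : HasFDerivAt (fun y : EuclideanSpace ℝ d => P (y q)) (deriv P (y q) • (EuclideanSpace.proj q : EuclideanSpace ℝ d →L[ℝ] ℝ)) y :=
    h2.comp_hasFDerivAt y h1
  unfold shearMapLift
  exact (hasFDerivAt_id y).sub (hφ.smul_const _)

/-- The derivative of the moving shear lift in a direction parallel to the displacement axis is
that direction itself. [folklore] -/
theorem hasFDerivAt_shearMapLift_apply_single (hpq : p ≠ q) (P : ShearProfile) (c : ℝ) (y : EuclideanSpace ℝ d) :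
    ∃ L : EuclideanSpace ℝ d →L[ℝ] EuclideanSpace ℝ d, HasFDerivAt (shearMapLift p q (ShearStage.amp P c)) L y ∧
      ∀ b : ℝ, L (b • EuclideanSpace.single p (1 : ℝ)) = b • EuclideanSpace.single p (1 : ℝ) := by
  refine ⟨_, hasFDerivAt_shearMapLift (ShearStage.amp P c) y, fun b => ?_⟩
  simp [hpq.symm]

/-- **Transport of a static profile by a moving shear.** For a smooth `Θ : T^d → ℝ`, a smooth
amplitude `a : ℝ → ℝ` and `p ≠ q`, the field `f(t, x) = Θ(x - a(t)φ(x_q)e_p)` satisfies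
`∂ₜf + ⟪V, ∇f⟫ = 0` with the drift `V(t, x) = ȧ(t)φ(x_q)e_p`, pointwise on `ℝ × T^d`
(Bardos–Titi–Wiedemann 2012, Lemma 4, in `d` dimensions). [folklore] -/
theorem transport_moved_static {Θ : UnitAddTorus d → ℝ} (hΘ : IsSmooth Θ) (hpq : p ≠ q) (P : ShearProfile)
    {a : ℝ → ℝ} (ha : ContDiff ℝ ∞ a) (t : ℝ) (x : UnitAddTorus d) :
    FunctionSpaces.Torus.timeDerivWithin univ (moved (fun _ => Θ) p q P a) t x +
      ⟪drift p q P (deriv a t) x, FunctionSpaces.Torus.gradient (moved (fun _ => Θ) p q P a t) x⟫_ℝ = 0 := by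
  obtain ⟨y, rfl⟩ := proj_surjective x
  set e : EuclideanSpace ℝ d := EuclideanSpace.single p (1 : ℝ) with he
  have hΘd : Differentiable ℝ (lift Θ) := hΘ.differentiable (by simp)
  -- the time derivative
  have hpath : HasDerivAt (fun τ : ℝ => shearMapLift p q (ShearStage.amp P (a τ)) y) (-((deriv a t * P (y q)) • e)) t := by
    unfold shearMapLift
    simp only [ShearStage.amp_apply]
    have h1 : HasDerivAt (fun τ => a τ * P (y q)) (deriv a t * P (y q)) t :=
      ((ha.differentiable (by simp)).differentiableAt.hasDerivAt).mul_const _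
    have h2 := (h1.smul_const e).const_sub y
    simpa using h2
  have htime : FunctionSpaces.Torus.timeDerivWithin univ (moved (fun _ => Θ) p q P a) t (proj y) =
      fderiv ℝ (lift Θ) (shearMapLift p q (ShearStage.amp P (a t)) y) (-((deriv a t * P (y q)) • e)) := by
    rw [FunctionSpaces.Torus.timeDerivWithin, derivWithin_univ]
    have hfun : (fun τ => moved (fun _ => Θ) p q P a τ (proj y)) = fun τ => lift Θ (shearMapLift p q (ShearStage.amp P (a τ)) y) := by
      funext τ; rw [moved_apply, shearMap_proj, lift_apply]
    rw [hfun]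
    exact ((hΘd _).hasFDerivAt.comp_hasDerivAt t hpath).deriv
  -- the advection term
  obtain ⟨L, hL, hLe⟩ := hasFDerivAt_shearMapLift_apply_single hpq P (a t) y
  have hspace : ⟪drift p q P (deriv a t) (proj y), FunctionSpaces.Torus.gradient (moved (fun _ => Θ) p q P a t) (proj y)⟫_ℝ =
      fderiv ℝ (lift Θ) (shearMapLift p q (ShearStage.amp P (a t)) y) ((deriv a t * P (y q)) • e) := by
    rw [real_inner_comm, FunctionSpaces.Torus.inner_gradient_left, ← fderiv_lift]
    have hlift : lift (moved (fun _ => Θ) p q P a t) = lift Θ ∘ shearMapLift p q (ShearStage.amp P (a t)) := by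
      funext y'; rw [lift_apply, Function.comp_apply, moved_apply, shearMap_proj, lift_apply]
    rw [hlift, fderiv_comp y (hΘd _) hL.differentiableAt, hL.fderiv, ContinuousLinearMap.comp_apply]
    congr 1
    rw [drift_apply, proj_apply, ShearProfile.onCircle_coe]
    exact hLe _
  rw [htime, hspace, map_neg, neg_add_cancel]

omit [Fintype d] [DecidableEq d] in
/-- **Locality of the time derivative**: fields that agree near a time have the same time
derivative there (within `univ`). [folklore] -/
theorem timeDerivWithin_univ_congr {V : Type*} [NormedAddCommGroup V] [NormedSpace ℝ V] {θ₁ θ₂ : ℝ → UnitAddTorus d → V}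
    {t : ℝ} (h : ∀ᶠ τ in 𝓝 t, θ₁ τ = θ₂ τ) (x : UnitAddTorus d) :
    FunctionSpaces.Torus.timeDerivWithin univ θ₁ t x = FunctionSpaces.Torus.timeDerivWithin univ θ₂ t x := by
  rw [FunctionSpaces.Torus.timeDerivWithin, FunctionSpaces.Torus.timeDerivWithin, derivWithin_univ, derivWithin_univ]
  have h' : (fun τ => θ₁ τ x) =ᶠ[𝓝 t] fun τ => θ₂ τ x := h.mono fun τ hτ => by simp only [hτ]
  exact h'.deriv_eq

end Drift

/-! ## The derivative profile and first derivatives of a sheared scalar -/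

section FirstDerivatives

/-- **The derivative profile** `φ'` of a smooth periodic profile `φ`. [folklore] -/
def _root_.Literature.Analysis.FunctionSpaces.Torus.ShearProfile.D (P : ShearProfile) : ShearProfile where
  toFun := deriv P
  periodic' := ShearCascade.periodic_deriv P.periodic
  contDiff' := P.contDiff.deriv'

/-- Values of the derivative profile. [folklore] -/
@[simp]
theorem _root_.Literature.Analysis.FunctionSpaces.Torus.ShearProfile.D_apply (P : ShearProfile) (t : ℝ) :
    P.D t = deriv P t := rfl

/-- The derived profile as a function. [folklore] -/
theorem _root_.Literature.Analysis.FunctionSpaces.Torus.ShearProfile.coe_D (P : ShearProfile) :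
    (P.D : ℝ → ℝ) = deriv P := rfl

variable {p q : d} {g : UnitAddTorus d → ℝ}

/-- The Fréchet derivative of the shear lift. [folklore] -/
theorem fderiv_shearMapLift (P : ShearProfile) (y : EuclideanSpace ℝ d) :
    fderiv ℝ (shearMapLift p q P) y =
      ContinuousLinearMap.id ℝ (EuclideanSpace ℝ d) -
        (deriv P (y q) • (EuclideanSpace.proj q : EuclideanSpace ℝ d →L[ℝ] ℝ)).smulRight
          (EuclideanSpace.single p (1 : ℝ)) :=
  (hasFDerivAt_shearMapLift P y).fderiv

/-- The derivative of the shear lift on the coordinate vectors: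
`DΦ̃(y) e_r = e_r - φ'(y_q) δ_{rq} e_p`. [folklore] -/
theorem fderiv_shearMapLift_single (P : ShearProfile) (y : EuclideanSpace ℝ d) (r : d) :
    fderiv ℝ (shearMapLift p q P) y (EuclideanSpace.single r (1 : ℝ)) =
      EuclideanSpace.single r (1 : ℝ) - (if r = q then deriv P (y q) else 0) • EuclideanSpace.single p (1 : ℝ) := by
  rw [fderiv_shearMapLift]
  by_cases hr : r = q
  · subst hr; simp
  · simp [hr, Ne.symm hr]

/-- **First derivatives of a sheared scalar**: for smooth `g` and `Φ(x) = x - φ(x_q)e_p`,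
`∂_r(g ∘ Φ)(x) = (∂_r g)(Φx) - δ_{rq} φ'(x_q) (∂_p g)(Φx)`. [folklore] -/
theorem partialDeriv_comp_shearMap (hg : IsSmooth g) (P : ShearProfile) (r : d) (x : UnitAddTorus d) :
    tPartialDeriv r (g ∘ shearMap p q P) x =
      tPartialDeriv r g (shearMap p q P x) -
        (if r = q then P.D.onCircle (x q) else 0) * tPartialDeriv p g (shearMap p q P x) := by
  obtain ⟨y, rfl⟩ := proj_surjective x
  have hg1 : IsContDiff 1 g := hg.isContDiff (by simp)
  have hgΦ : IsSmooth (g ∘ shearMap p q P) := hg.comp_shearMap p q P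
  have hgΦ1 : IsContDiff 1 (g ∘ shearMap p q P) := hgΦ.isContDiff (by simp)
  have hdg : Differentiable ℝ (lift g) := hg.differentiable (by simp)
  have hdΦ : Differentiable ℝ (shearMapLift p q P) := (contDiff_shearMapLift p q P).differentiable (by simp)
  rw [partialDeriv_eq_fderiv_apply hgΦ1, ← fderiv_lift, lift_comp_shearMap,
    fderiv_comp y (hdg _) (hdΦ y), ContinuousLinearMap.comp_apply, fderiv_shearMapLift_single, map_sub,
    map_smul, fderiv_lift, ← shearMap_proj, ← partialDeriv_eq_fderiv_apply hg1,
    ← partialDeriv_eq_fderiv_apply hg1, smul_eq_mul]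
  congr 2

/-- First derivatives of a sheared scalar in the directions `r ≠ q` are just transported. [folklore] -/
theorem partialDeriv_comp_shearMap_of_ne (hg : IsSmooth g) (P : ShearProfile) {r : d} (hr : r ≠ q) (x : UnitAddTorus d) :
    tPartialDeriv r (g ∘ shearMap p q P) x = tPartialDeriv r g (shearMap p q P x) := by
  rw [partialDeriv_comp_shearMap hg P r x, if_neg hr, zero_mul, sub_zero]

/-- The first derivative of a sheared scalar in the driving direction `q`. [folklore] -/
theorem partialDeriv_comp_shearMap_same (hg : IsSmooth g) (P : ShearProfile) (x : UnitAddTorus d) :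
    tPartialDeriv q (g ∘ shearMap p q P) x =
      tPartialDeriv q g (shearMap p q P x) - P.D.onCircle (x q) * tPartialDeriv p g (shearMap p q P x) := by
  rw [partialDeriv_comp_shearMap hg P q x, if_pos rfl]

/-- **`L²` norms of the transported derivatives are unchanged** (`r ≠ q`). [folklore] -/
theorem integral_sq_partialDeriv_comp_shearMap_of_ne (hg : IsSmooth g) (hpq : p ≠ q) (P : ShearProfile)
    {r : d} (hr : r ≠ q) :
    ∫ x, tPartialDeriv r (g ∘ shearMap p q P) x ^ 2 = ∫ x, tPartialDeriv r g x ^ 2 := by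
  simp_rw [partialDeriv_comp_shearMap_of_ne hg P hr]
  exact integral_comp_shearMap' hpq P (fun x => tPartialDeriv r g x ^ 2)

/-- **The `L²` norm of the derivative in the driving direction after a shear**:
`‖∂_q(g∘Φ)‖² = ‖∂_q g‖² - 2∫ φ'(x_q) ∂_q g ∂_p g + ∫ φ'(x_q)² (∂_p g)²` (change of variables by
the volume-preserving `Φ`, which fixes `x_q`). [folklore] -/
theorem integral_sq_partialDeriv_comp_shearMap_same (hg : IsSmooth g) (hpq : p ≠ q) (P : ShearProfile) :
    ∫ x, tPartialDeriv q (g ∘ shearMap p q P) x ^ 2 =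
      (∫ x, tPartialDeriv q g x ^ 2) -
        2 * (∫ x, P.D.onCircle (x q) * (tPartialDeriv q g x * tPartialDeriv p g x)) +
        ∫ x, P.D.onCircle (x q) ^ 2 * tPartialDeriv p g x ^ 2 := by
  set F : UnitAddTorus d → ℝ := fun z =>
    (tPartialDeriv q g z - P.D.onCircle (z q) * tPartialDeriv p g z) ^ 2 with hF
  have hpt : ∀ x, tPartialDeriv q (g ∘ shearMap p q P) x ^ 2 = F (shearMap p q P x) := by
    intro x
    rw [partialDeriv_comp_shearMap_same hg P x, hF]
    simp only
    rw [shearMap_apply_of_ne P x (Ne.symm hpq)]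
  simp_rw [hpt]
  rw [integral_comp_shearMap' hpq P F]
  -- expand the square
  have hc : Continuous fun z : UnitAddTorus d => P.D.onCircle (z q) := (isSmooth_onCircle_comp q P.D).continuous
  have hA : Continuous fun z => tPartialDeriv q g z := (hg.partialDeriv q).continuous
  have hB : Continuous fun z => tPartialDeriv p g z := (hg.partialDeriv p).continuous
  have e : F = fun z => (tPartialDeriv q g z ^ 2 - 2 * (P.D.onCircle (z q) * (tPartialDeriv q g z * tPartialDeriv p g z))) +
      P.D.onCircle (z q) ^ 2 * tPartialDeriv p g z ^ 2 := by
    funext z; simp only [hF]; ring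
  have h1 : Integrable (fun z => tPartialDeriv q g z ^ 2) volume := (hA.pow 2).integrable_unitAddTorus
  have h2 : Integrable (fun z => 2 * (P.D.onCircle (z q) * (tPartialDeriv q g z * tPartialDeriv p g z))) volume :=
    (continuous_const.mul (hc.mul (hA.mul hB))).integrable_unitAddTorus
  have h3 : Integrable (fun z => P.D.onCircle (z q) ^ 2 * tPartialDeriv p g z ^ 2) volume :=
    ((hc.pow 2).mul (hB.pow 2)).integrable_unitAddTorus
  have h12 : Integrable (fun z => tPartialDeriv q g z ^ 2 -
      2 * (P.D.onCircle (z q) * (tPartialDeriv q g z * tPartialDeriv p g z))) volume := h1.sub h2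
  rw [e]
  dsimp only
  rw [integral_add h12 h3, integral_sub h1 h2, integral_const_mul]

/-- The `L²` norm of the sheared scalar itself is unchanged. [folklore] -/
theorem integral_sq_comp_shearMap (hpq : p ≠ q) (P : ShearProfile) (g : UnitAddTorus d → ℝ) :
    ∫ x, (g ∘ shearMap p q P) x ^ 2 = ∫ x, g x ^ 2 :=
  integral_comp_shearMap' hpq P (fun x => g x ^ 2)

end FirstDerivatives

/-! ## The Hessian of a torus scalar and its growth under one shear -/

section Hessian

variable {p q : d} {g : UnitAddTorus d → ℝ}

/-- **The Hessian** of `g : T^d → ℝ` at `x`: the second Fréchet derivative of the re-centred lift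
at `0`, a continuous bilinear form on `ℝ^d` (measured in the operator norm). [folklore] -/
def hess (g : UnitAddTorus d → ℝ) (x : UnitAddTorus d) :
    EuclideanSpace ℝ d →L[ℝ] EuclideanSpace ℝ d →L[ℝ] ℝ :=
  fderiv ℝ (fderiv ℝ (liftAt g x)) 0

omit [DecidableEq d] in
/-- The Hessian through the global lift: `hess g (proj y) = D²(lift g)(y)`. [folklore] -/
theorem hess_proj (g : UnitAddTorus d → ℝ) (y : EuclideanSpace ℝ d) :
    hess g (proj y) = fderiv ℝ (fderiv ℝ (lift g)) y := by
  rw [hess, liftAt_proj]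
  have e : fderiv ℝ (fun v => lift g (y + v)) = fun v => fderiv ℝ (lift g) (y + v) := by
    funext v; exact fderiv_comp_add_left y
  change fderiv ℝ (fderiv ℝ (fun v => lift g (y + v))) 0 = _
  rw [e, fderiv_comp_add_left, add_zero]

omit [DecidableEq d] in
/-- The Hessian of a smooth scalar is continuous. [folklore] -/
theorem continuous_hess (hg : IsSmooth g) : Continuous (hess g) := by
  rw [← (isOpenQuotientMap_proj (d := d)).continuous_comp_iff]
  have e : hess g ∘ proj = fderiv ℝ (fderiv ℝ (lift g)) := funext fun y => hess_proj g y
  rw [e]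
  exact ((hg.fderiv_right (m := ∞) le_rfl).continuous_fderiv (by simp))

omit [DecidableEq d] in
/-- The gradient and the Fréchet derivative have the same norm. [folklore] -/
theorem norm_gradient_eq_norm_fderiv (g : UnitAddTorus d → ℝ) (x : UnitAddTorus d) :
    ‖gradient g x‖ = ‖FunctionSpaces.Torus.fderiv g x‖ := by
  rw [FunctionSpaces.Torus.gradient, _root_.gradient]
  exact (InnerProductSpace.toDual ℝ (EuclideanSpace ℝ d)).symm.norm_map _

/-- Second partial derivatives are diagonal entries of the Hessian:
`∂ᵢ∂ᵢ g (x) = hess g x eᵢ eᵢ`. [folklore] -/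
theorem partialDeriv_partialDeriv_eq_hess (hg : IsSmooth g) (i : d) (x : UnitAddTorus d) :
    tPartialDeriv i (tPartialDeriv i g) x = hess g x (EuclideanSpace.single i (1 : ℝ)) (EuclideanSpace.single i (1 : ℝ)) := by
  obtain ⟨y, rfl⟩ := proj_surjective x
  have hg1 : IsContDiff 1 g := hg.isContDiff (by simp)
  have hgi1 : IsContDiff 1 (tPartialDeriv i g) := (hg.partialDeriv i).isContDiff (by simp)
  have e : lift (tPartialDeriv i g) = fun y' => fderiv ℝ (lift g) y' (EuclideanSpace.single i (1 : ℝ)) := by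
    funext y'
    rw [lift_apply, partialDeriv_eq_fderiv_apply hg1, ← fderiv_lift]
  have hc : DifferentiableAt ℝ (fderiv ℝ (lift g)) y :=
    ((hg.fderiv_right (m := ∞) le_rfl).differentiable (by simp)).differentiableAt
  rw [partialDeriv_eq_fderiv_apply hgi1, ← fderiv_lift, e, fderiv_clm_apply hc (differentiableAt_const _),
    fderiv_fun_const, hess_proj]
  simp

/-- **The Laplacian is controlled by the Hessian**: `(Δg)² ≤ (card d)² ‖hess g‖²`. [folklore] -/
theorem sq_laplacian_le (hg : IsSmooth g) (x : UnitAddTorus d) :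
    laplacian g x ^ 2 ≤ (Fintype.card d : ℝ) ^ 2 * ‖hess g x‖ ^ 2 := by
  have h1 : |laplacian g x| ≤ (Fintype.card d : ℝ) * ‖hess g x‖ := by
    rw [laplacian_eq_sum_partialDeriv_partialDeriv hg]
    calc |∑ i, tPartialDeriv i (tPartialDeriv i g) x|
        ≤ ∑ i, |tPartialDeriv i (tPartialDeriv i g) x| := Finset.abs_sum_le_sum_abs _ _
      _ ≤ ∑ _i : d, ‖hess g x‖ := Finset.sum_le_sum fun i _ => by
          rw [partialDeriv_partialDeriv_eq_hess hg i x, ← Real.norm_eq_abs]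
          calc ‖hess g x (EuclideanSpace.single i (1 : ℝ)) (EuclideanSpace.single i (1 : ℝ))‖
              ≤ ‖hess g x‖ * ‖EuclideanSpace.single i (1 : ℝ)‖ * ‖EuclideanSpace.single i (1 : ℝ)‖ :=
                (hess g x).le_opNorm₂ _ _
            _ = ‖hess g x‖ := by simp
      _ = (Fintype.card d : ℝ) * ‖hess g x‖ := by simp
  have h0 : 0 ≤ (Fintype.card d : ℝ) * ‖hess g x‖ := by positivity
  calc laplacian g x ^ 2 = |laplacian g x| ^ 2 := (sq_abs _).symm
    _ ≤ ((Fintype.card d : ℝ) * ‖hess g x‖) ^ 2 := pow_le_pow_left₀ (abs_nonneg _) h1 2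
    _ = (Fintype.card d : ℝ) ^ 2 * ‖hess g x‖ ^ 2 := by ring

/-- The rank-one map `v ↦ v_q e_p` has norm at most one. [folklore] -/
theorem norm_proj_smulRight_single_le (p q : d) :
    ‖((EuclideanSpace.proj q : EuclideanSpace ℝ d →L[ℝ] ℝ)).smulRight (EuclideanSpace.single p (1 : ℝ))‖ ≤ 1 := by
  rw [ContinuousLinearMap.norm_smulRight_apply]
  have h : ‖(EuclideanSpace.proj q : EuclideanSpace ℝ d →L[ℝ] ℝ)‖ ≤ 1 := by
    refine ContinuousLinearMap.opNorm_le_bound _ zero_le_one fun v => ?_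
    rw [one_mul]
    exact PiLp.norm_apply_le v q
  calc ‖(EuclideanSpace.proj q : EuclideanSpace ℝ d →L[ℝ] ℝ)‖ * ‖EuclideanSpace.single p (1 : ℝ)‖ ≤ 1 * 1 := by
        gcongr; simp
    _ = 1 := one_mul _

set_option maxSynthPendingDepth 2 in
/-- **The Hessian of a sheared scalar, pointwise**: with `Φ(x) = x - φ(x_q)e_p`,
`‖hess (g ∘ Φ)(x)‖ ≤ (1 + |φ'(x_q)|)² ‖hess g (Φx)‖ + |φ''(x_q)| ‖∇g(Φx)‖` (second-order chain
rule: `D²(g̃∘Φ̃) = D²g̃[DΦ̃·, DΦ̃·] + Dg̃ ∘ D²Φ̃`, `‖DΦ̃‖ ≤ 1 + |φ'|`, `‖D²Φ̃‖ ≤ |φ''|`). [folklore] -/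
theorem norm_hess_comp_shearMap_le (hg : IsSmooth g) (P : ShearProfile) (x : UnitAddTorus d) :
    ‖hess (g ∘ shearMap p q P) x‖ ≤
      (1 + |P.D.onCircle (x q)|) ^ 2 * ‖hess g (shearMap p q P x)‖ +
        |P.D.D.onCircle (x q)| * ‖gradient g (shearMap p q P x)‖ := by
  obtain ⟨y, rfl⟩ := proj_surjective x
  obtain ⟨πq, hπq⟩ : ∃ πq : EuclideanSpace ℝ d →L[ℝ] ℝ, πq = EuclideanSpace.proj q := ⟨_, rfl⟩
  obtain ⟨T, hT⟩ : ∃ T : EuclideanSpace ℝ d →L[ℝ] EuclideanSpace ℝ d,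
      T = πq.smulRight (EuclideanSpace.single p (1 : ℝ)) := ⟨_, rfl⟩
  have hπq_apply : ∀ v : EuclideanSpace ℝ d, πq v = v q := fun v => by rw [hπq]; rfl
  have hπq1 : ‖πq‖ ≤ 1 := by
    refine ContinuousLinearMap.opNorm_le_bound _ zero_le_one fun v => ?_
    rw [one_mul, hπq_apply]
    exact PiLp.norm_apply_le v q
  have hT1 : ‖T‖ ≤ 1 := by
    have h1 : ‖EuclideanSpace.single p (1 : ℝ)‖ = 1 := by simp
    rw [hT, ContinuousLinearMap.norm_smulRight_apply, h1, mul_one]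
    exact hπq1
  -- derivatives of the lift of `g`
  have hdg : Differentiable ℝ (lift g) := hg.differentiable (by simp)
  have hD2 : Differentiable ℝ (fderiv ℝ (lift g)) := (hg.fderiv_right (m := ∞) le_rfl).differentiable (by simp)
  -- first derivative of the shear lift: `id - φ'(y'_q) T`
  have hDΦ : ∀ y' : EuclideanSpace ℝ d, HasFDerivAt (shearMapLift p q P)
      (ContinuousLinearMap.id ℝ (EuclideanSpace ℝ d) - deriv P (y' q) • T) y' := by
    intro y'
    have e : deriv P (y' q) • T =
        (deriv P (y' q) • (EuclideanSpace.proj q : EuclideanSpace ℝ d →L[ℝ] ℝ)).smulRight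
          (EuclideanSpace.single p (1 : ℝ)) := by
      refine ContinuousLinearMap.ext fun v => ?_
      rw [hT, hπq]
      simp [smul_smul]
    rw [e]
    exact hasFDerivAt_shearMapLift P y'
  have hfdΦ : ∀ y' : EuclideanSpace ℝ d, fderiv ℝ (shearMapLift p q P) y' =
      ContinuousLinearMap.id ℝ (EuclideanSpace ℝ d) - deriv P (y' q) • T := fun y' => (hDΦ y').fderiv
  -- second derivative of the shear lift: `-(φ''(y_q) π_q) ⊗ T`
  have hD2Φ : HasFDerivAt (fun y' => fderiv ℝ (shearMapLift p q P) y')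
      (-((deriv (deriv P) (y q) • πq).smulRight T)) y := by
    rw [show (fun y' => fderiv ℝ (shearMapLift p q P) y') =
        fun y' => ContinuousLinearMap.id ℝ (EuclideanSpace ℝ d) - deriv P (y' q) • T from funext hfdΦ]
    have h1 : HasFDerivAt (fun y' : EuclideanSpace ℝ d => y' q) πq y := by
      rw [hπq]; exact (EuclideanSpace.proj q : EuclideanSpace ℝ d →L[ℝ] ℝ).hasFDerivAt
    have h2 : HasDerivAt (deriv P) (deriv (deriv P) (y q)) (y q) :=
      (P.D.contDiff.differentiable (by simp)).differentiableAt.hasDerivAt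
    have h3 : HasFDerivAt (fun y' : EuclideanSpace ℝ d => deriv P (y' q)) (deriv (deriv P) (y q) • πq) y := by
      have h := h2.comp_hasFDerivAt y h1
      rwa [Function.comp_def] at h
    exact (h3.smul_const T).const_sub (ContinuousLinearMap.id ℝ (EuclideanSpace ℝ d))
  -- the chain rule for `y ↦ Dg̃(Φ̃ y)`
  have hc : HasFDerivAt (fun y' => fderiv ℝ (lift g) (shearMapLift p q P y'))
      ((fderiv ℝ (fderiv ℝ (lift g)) (shearMapLift p q P y)).comp (fderiv ℝ (shearMapLift p q P) y)) y :=
    (hD2 (shearMapLift p q P y)).hasFDerivAt.comp y (hDΦ y).differentiableAt.hasFDerivAt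
  -- the derivative of the composite `y ↦ Dg̃(Φ̃y) ∘ DΦ̃(y)`
  have hcomp := hc.clm_comp hD2Φ
  have hlift : lift (g ∘ shearMap p q P) = lift g ∘ shearMapLift p q P := lift_comp_shearMap p q P g
  have hfd1 : fderiv ℝ (lift (g ∘ shearMap p q P)) =
      fun y' => (fderiv ℝ (lift g) (shearMapLift p q P y')).comp (fderiv ℝ (shearMapLift p q P) y') := by
    funext y'
    rw [hlift, fderiv_comp y' (hdg _) ((hDΦ y').differentiableAt)]
  -- express everything through the lifts
  have hg1 : ‖gradient g (shearMap p q P (proj y))‖ = ‖fderiv ℝ (lift g) (shearMapLift p q P y)‖ := by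
    rw [norm_gradient_eq_norm_fderiv, fderiv_lift, shearMap_proj]
  have hh1 : ‖hess g (shearMap p q P (proj y))‖ = ‖fderiv ℝ (fderiv ℝ (lift g)) (shearMapLift p q P y)‖ := by
    rw [shearMap_proj, hess_proj]
  have hP1 : P.D.onCircle (proj y q) = deriv P (y q) := by
    rw [proj_apply, ShearProfile.onCircle_coe, ShearProfile.D_apply]
  have hP2 : P.D.D.onCircle (proj y q) = deriv (deriv P) (y q) := by
    rw [proj_apply, ShearProfile.onCircle_coe, ShearProfile.D_apply, ShearProfile.coe_D]
  rw [hg1, hh1, hP1, hP2, hess_proj, hfd1, hcomp.fderiv]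
  -- the norms of the pieces
  set Dg := fderiv ℝ (lift g) (shearMapLift p q P y) with hDg
  set D2g := fderiv ℝ (fderiv ℝ (lift g)) (shearMapLift p q P y) with hD2g
  set DΦ := fderiv ℝ (shearMapLift p q P) y with hDΦy
  have hnD : ‖DΦ‖ ≤ 1 + |deriv P (y q)| := by
    rw [hDΦy, hfdΦ y]
    calc ‖ContinuousLinearMap.id ℝ (EuclideanSpace ℝ d) - deriv P (y q) • T‖
        ≤ ‖ContinuousLinearMap.id ℝ (EuclideanSpace ℝ d)‖ + ‖deriv P (y q) • T‖ := norm_sub_le _ _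
      _ ≤ 1 + |deriv P (y q)| * 1 := by
          refine add_le_add ContinuousLinearMap.norm_id_le ?_
          rw [norm_smul, Real.norm_eq_abs]
          exact mul_le_mul_of_nonneg_left hT1 (abs_nonneg _)
      _ = 1 + |deriv P (y q)| := by rw [mul_one]
  have hn2 : ‖-((deriv (deriv P) (y q) • πq).smulRight T)‖ ≤ |deriv (deriv P) (y q)| := by
    rw [norm_neg, ContinuousLinearMap.norm_smulRight_apply, norm_smul, Real.norm_eq_abs]
    calc |deriv (deriv P) (y q)| * ‖πq‖ * ‖T‖ ≤ |deriv (deriv P) (y q)| * 1 * 1 := by gcongr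
      _ = |deriv (deriv P) (y q)| := by ring
  have hA : ‖(ContinuousLinearMap.compL ℝ (EuclideanSpace ℝ d) (EuclideanSpace ℝ d) ℝ Dg).comp
      (-((deriv (deriv P) (y q) • πq).smulRight T))‖ ≤ ‖Dg‖ * |deriv (deriv P) (y q)| := by
    refine (ContinuousLinearMap.opNorm_comp_le _ _).trans ?_
    refine mul_le_mul ?_ hn2 (norm_nonneg _) (norm_nonneg _)
    calc ‖ContinuousLinearMap.compL ℝ (EuclideanSpace ℝ d) (EuclideanSpace ℝ d) ℝ Dg‖
        ≤ ‖ContinuousLinearMap.compL ℝ (EuclideanSpace ℝ d) (EuclideanSpace ℝ d) ℝ‖ * ‖Dg‖ :=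
          ContinuousLinearMap.le_opNorm _ _
      _ ≤ 1 * ‖Dg‖ := mul_le_mul_of_nonneg_right (ContinuousLinearMap.norm_compL_le _ _ _ _) (norm_nonneg _)
      _ = ‖Dg‖ := one_mul _
  have hB : ‖((ContinuousLinearMap.compL ℝ (EuclideanSpace ℝ d) (EuclideanSpace ℝ d) ℝ).flip DΦ).comp (D2g.comp DΦ)‖ ≤
      (1 + |deriv P (y q)|) * (‖D2g‖ * (1 + |deriv P (y q)|)) := by
    refine (ContinuousLinearMap.opNorm_comp_le _ _).trans ?_
    refine mul_le_mul ?_ ((ContinuousLinearMap.opNorm_comp_le _ _).trans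
      (mul_le_mul_of_nonneg_left hnD (norm_nonneg _))) (norm_nonneg _) (by positivity)
    calc ‖(ContinuousLinearMap.compL ℝ (EuclideanSpace ℝ d) (EuclideanSpace ℝ d) ℝ).flip DΦ‖
        ≤ ‖(ContinuousLinearMap.compL ℝ (EuclideanSpace ℝ d) (EuclideanSpace ℝ d) ℝ).flip‖ * ‖DΦ‖ :=
          ContinuousLinearMap.le_opNorm _ _
      _ ≤ 1 * (1 + |deriv P (y q)|) := by
          refine mul_le_mul ?_ hnD (norm_nonneg _) zero_le_one
          rw [ContinuousLinearMap.opNorm_flip]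
          exact ContinuousLinearMap.norm_compL_le _ _ _ _
      _ = 1 + |deriv P (y q)| := one_mul _
  calc ‖(ContinuousLinearMap.compL ℝ (EuclideanSpace ℝ d) (EuclideanSpace ℝ d) ℝ Dg).comp
          (-((deriv (deriv P) (y q) • πq).smulRight T)) +
        ((ContinuousLinearMap.compL ℝ (EuclideanSpace ℝ d) (EuclideanSpace ℝ d) ℝ).flip DΦ).comp (D2g.comp DΦ)‖
      ≤ ‖Dg‖ * |deriv (deriv P) (y q)| + (1 + |deriv P (y q)|) * (‖D2g‖ * (1 + |deriv P (y q)|)) :=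
        (norm_add_le _ _).trans (add_le_add hA hB)
    _ = (1 + |deriv P (y q)|) ^ 2 * ‖D2g‖ + |deriv (deriv P) (y q)| * ‖Dg‖ := by ring

set_option maxSynthPendingDepth 2 in
/-- **Integrated growth of the Hessian under one shear.** If `|φ'| ≤ K₁`, then
`(∫‖hess (g∘Φ)‖²)^{1/2} ≤ (1 + K₁)² (∫‖hess g‖²)^{1/2} + (∫ φ''(x_q)² ‖∇g‖²)^{1/2}`
(pointwise bound, Minkowski, and the change of variables by `Φ`, which fixes `x_q`). [folklore] -/
theorem sqrt_integral_hess_comp_shearMap_le (hg : IsSmooth g) (hpq : p ≠ q) (P : ShearProfile)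
    {K₁ : ℝ} (hK₁ : ∀ t, |deriv P t| ≤ K₁) :
    Real.sqrt (∫ x, ‖hess (g ∘ shearMap p q P) x‖ ^ 2) ≤
      (1 + K₁) ^ 2 * Real.sqrt (∫ x, ‖hess g x‖ ^ 2) +
        Real.sqrt (∫ x, P.D.D.onCircle (x q) ^ 2 * ‖gradient g x‖ ^ 2) := by
  have hK₁0 : 0 ≤ K₁ := (abs_nonneg _).trans (hK₁ 0)
  set f : UnitAddTorus d → ℝ := fun x => (1 + K₁) ^ 2 * ‖hess g (shearMap p q P x)‖ with hf
  set h : UnitAddTorus d → ℝ := fun x => |P.D.D.onCircle (x q)| * ‖gradient g (shearMap p q P x)‖ with hh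
  have hc1 : Continuous fun x => hess g (shearMap p q P x) := (continuous_hess hg).comp (continuous_shearMap p q P)
  have hc2 : Continuous fun x => gradient g (shearMap p q P x) :=
    hg.gradient.continuous.comp (continuous_shearMap p q P)
  have hc1n : Continuous fun x => ‖hess g (shearMap p q P x)‖ := hc1.norm
  have hc2n : Continuous fun x => ‖gradient g (shearMap p q P x)‖ := hc2.norm
  have hfc : Continuous f := continuous_const.mul hc1n
  have hcD : Continuous fun z : UnitAddTorus d => P.D.onCircle (z q) := (isSmooth_onCircle_comp q P.D).continuous
  have hcDD : Continuous fun z : UnitAddTorus d => P.D.D.onCircle (z q) := (isSmooth_onCircle_comp q P.D.D).continuous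
  have hhc : Continuous h := hcDD.abs.mul hc2n
  -- pointwise
  have hpt : ∀ x, ‖hess (g ∘ shearMap p q P) x‖ ^ 2 ≤ (f x + h x) ^ 2 := by
    intro x
    refine pow_le_pow_left₀ (norm_nonneg _) ((norm_hess_comp_shearMap_le hg P x).trans ?_) 2
    simp only [hf, hh]
    refine add_le_add (mul_le_mul_of_nonneg_right ?_ (norm_nonneg _)) le_rfl
    have hb : |P.D.onCircle (x q)| ≤ K₁ := by
      induction x q using QuotientAddGroup.induction_on with
      | H t => rw [ShearProfile.onCircle_coe]; exact hK₁ t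
    exact pow_le_pow_left₀ (by positivity) (by linarith) 2
  have hI : ∫ x, ‖hess (g ∘ shearMap p q P) x‖ ^ 2 ≤ ∫ x, (f x + h x) ^ 2 :=
    integral_mono ((continuous_hess (hg.comp_shearMap p q P)).norm.pow 2).integrable_unitAddTorus
      ((hfc.add hhc).pow 2).integrable_unitAddTorus hpt
  refine (Real.sqrt_le_sqrt hI).trans ((sqrt_integral_add_sq_le hfc hhc).trans ?_)
  -- the two pieces after the change of variables
  have e1 : ∫ x, f x ^ 2 = ((1 + K₁) ^ 2) ^ 2 * ∫ x, ‖hess g x‖ ^ 2 := by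
    simp only [hf, mul_pow]
    rw [integral_const_mul, integral_comp_shearMap' hpq P (fun x => ‖hess g x‖ ^ 2)]
  have e2 : ∫ x, h x ^ 2 = ∫ x, P.D.D.onCircle (x q) ^ 2 * ‖gradient g x‖ ^ 2 := by
    have e : ∀ x, h x ^ 2 = (fun z => P.D.D.onCircle (z q) ^ 2 * ‖gradient g z‖ ^ 2) (shearMap p q P x) := by
      intro x
      simp only [hh, mul_pow, sq_abs]
      rw [shearMap_apply_of_ne P x (Ne.symm hpq)]
    simp_rw [e]
    exact integral_comp_shearMap' hpq P (fun z => P.D.D.onCircle (z q) ^ 2 * ‖gradient g z‖ ^ 2)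
  rw [e1, e2, Real.sqrt_mul' _ (integral_nonneg fun _ => sq_nonneg _), Real.sqrt_sq (by positivity)]

end Hessian

/-! ## Smoothed sawtooth profiles: the slope wave `w_ε` and its primitive `S_ε` -/

section Profiles

/-- **The slope wave** `w_ε`: `+1` for `fract y ≤ 1/4`, `-1` on `[1/4 + 2ε, 3/4]`, `+1` again on
`[3/4 + 2ε, 1)`, with smooth monotone transitions of width `2ε` (Mathlib's
`Real.smoothTransition`); the derivative of a triangle wave with exactly flattened corners. [folklore] -/
def slopeWave (ε y : ℝ) : ℝ :=
  1 - 2 * Real.smoothTransition ((Int.fract y - 4⁻¹) / (2 * ε)) +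
    2 * Real.smoothTransition ((Int.fract y - 3 / 4) / (2 * ε))

/-- The smooth global representative of the slope wave on the period `[n, n+1)`. [folklore] -/
def slopeWaveAux (ε : ℝ) (n : ℤ) (z : ℝ) : ℝ :=
  1 - 2 * Real.smoothTransition ((z - n - 4⁻¹) / (2 * ε)) +
    2 * Real.smoothTransition ((z - n - 3 / 4) / (2 * ε))

/-- The slope wave is `1`-periodic. [folklore] -/
theorem slopeWave_periodic (ε : ℝ) : Function.Periodic (slopeWave ε) 1 := fun y => by
  simp [slopeWave, Int.fract_add_one]

/-- The slope wave only depends on the fractional part. [folklore] -/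
theorem slopeWave_eq_of_fract_eq {ε y z : ℝ} (h : Int.fract y = Int.fract z) : slopeWave ε y = slopeWave ε z := by
  simp [slopeWave, h]

/-- The auxiliary representatives are smooth. [folklore] -/
theorem contDiff_slopeWaveAux (ε : ℝ) (n : ℤ) : ContDiff ℝ ∞ (slopeWaveAux ε n) := by
  have h1 : ContDiff ℝ ∞ fun z : ℝ => (z - n - 4⁻¹) / (2 * ε) :=
    ((contDiff_id.sub contDiff_const).sub contDiff_const).div_const _
  have h2 : ContDiff ℝ ∞ fun z : ℝ => (z - n - 3 / 4) / (2 * ε) :=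
    ((contDiff_id.sub contDiff_const).sub contDiff_const).div_const _
  unfold slopeWaveAux
  exact (contDiff_const.sub (contDiff_const.mul (Real.smoothTransition.contDiff.comp h1))).add
    (contDiff_const.mul (Real.smoothTransition.contDiff.comp h2))

/-- On the period containing `y`, the slope wave is its auxiliary representative. [folklore] -/
theorem slopeWave_eq_aux {ε y z : ℝ} (hz : ⌊z⌋ = ⌊y⌋) : slopeWave ε z = slopeWaveAux ε ⌊y⌋ z := by
  simp only [slopeWave, slopeWaveAux, Int.fract, hz]

/-- Near a non-integer the slope wave coincides with a smooth global function. [folklore] -/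
theorem slopeWave_eventuallyEq_aux {ε y : ℝ} (hy : Int.fract y ≠ 0) :
    slopeWave ε =ᶠ[𝓝 y] slopeWaveAux ε ⌊y⌋ := by
  have h1 : (⌊y⌋ : ℝ) < y := by
    refine lt_of_le_of_ne (Int.floor_le y) fun h => hy ?_
    rw [Int.fract, h, sub_self]
  have h2 : y < ⌊y⌋ + 1 := Int.lt_floor_add_one y
  have hfl : ∀ᶠ z in 𝓝 y, ⌊z⌋ = ⌊y⌋ := by
    filter_upwards [Ioo_mem_nhds h1 h2] with z hz
    exact Int.floor_eq_iff.2 ⟨hz.1.le, hz.2⟩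
  exact hfl.mono fun z hz => slopeWave_eq_aux hz

/-- Near an integer the slope wave is identically `1` (if `ε ≤ 1/16`). [folklore] -/
theorem slopeWave_eventuallyEq_one {ε : ℝ} (hε : 0 < ε) (hε' : ε ≤ 1 / 16) {y : ℝ} (hy : Int.fract y = 0) :
    slopeWave ε =ᶠ[𝓝 y] fun _ => (1 : ℝ) := by
  have hyn : y = ⌊y⌋ := by
    have h := hy; rw [Int.fract, sub_eq_zero] at h; exact h
  set n : ℤ := ⌊y⌋ with hn
  have hlo : (n : ℝ) - 8⁻¹ < y := by rw [hyn]; linarith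
  have hhi : y < (n : ℝ) + 8⁻¹ := by rw [hyn]; linarith
  filter_upwards [Ioo_mem_nhds hlo hhi] with z hz
  rcases le_or_gt (n : ℝ) z with hzn | hzn
  · -- `fract z = z - n ∈ [0, 1/8)`
    have hfl : ⌊z⌋ = n := Int.floor_eq_iff.2 ⟨hzn, by linarith [hz.2]⟩
    have hfr : Int.fract z = z - n := by rw [Int.fract, hfl]
    have ha : (Int.fract z - 4⁻¹) / (2 * ε) ≤ 0 :=
      div_nonpos_of_nonpos_of_nonneg (by rw [hfr]; linarith [hz.2]) (by positivity)
    have hb : (Int.fract z - 3 / 4) / (2 * ε) ≤ 0 :=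
      div_nonpos_of_nonpos_of_nonneg (by rw [hfr]; linarith [hz.2]) (by positivity)
    simp [slopeWave, Real.smoothTransition.zero_of_nonpos ha, Real.smoothTransition.zero_of_nonpos hb]
  · -- `fract z = z - n + 1 ∈ (7/8, 1)`
    have hfl : ⌊z⌋ = n - 1 := Int.floor_eq_iff.2 ⟨by push_cast; linarith [hz.1], by push_cast; linarith⟩
    have hfr : Int.fract z = z - n + 1 := by rw [Int.fract, hfl]; push_cast; ring
    have ha : 1 ≤ (Int.fract z - 4⁻¹) / (2 * ε) := by
      rw [le_div_iff₀ (by positivity), hfr]; nlinarith [hz.1]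
    have hb : 1 ≤ (Int.fract z - 3 / 4) / (2 * ε) := by
      rw [le_div_iff₀ (by positivity), hfr]; nlinarith [hz.1]
    simp only [slopeWave, Real.smoothTransition.one_of_one_le ha, Real.smoothTransition.one_of_one_le hb]
    ring

/-- **The slope wave is smooth** (`0 < ε ≤ 1/16`). [folklore] -/
theorem contDiff_slopeWave {ε : ℝ} (hε : 0 < ε) (hε' : ε ≤ 1 / 16) : ContDiff ℝ ∞ (slopeWave ε) := by
  refine contDiff_iff_contDiffAt.2 fun y => ?_
  by_cases hy : Int.fract y = 0
  · exact (contDiffAt_const (c := (1 : ℝ))).congr_of_eventuallyEq (slopeWave_eventuallyEq_one hε hε' hy)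
  · exact (contDiff_slopeWaveAux ε ⌊y⌋).contDiffAt.congr_of_eventuallyEq (slopeWave_eventuallyEq_aux hy)

/-- The slope wave is continuous. [folklore] -/
theorem continuous_slopeWave {ε : ℝ} (hε : 0 < ε) (hε' : ε ≤ 1 / 16) : Continuous (slopeWave ε) :=
  (contDiff_slopeWave hε hε').continuous

/-- **`|w_ε| ≤ 1`.** [folklore] -/
theorem abs_slopeWave_le {ε : ℝ} (hε : 0 < ε) (hε' : ε ≤ 1 / 16) (y : ℝ) : |slopeWave ε y| ≤ 1 := by
  have hf0 : 0 ≤ Int.fract y := Int.fract_nonneg y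
  have hf1 : Int.fract y < 1 := Int.fract_lt_one y
  have ha0 := Real.smoothTransition.nonneg ((Int.fract y - 4⁻¹) / (2 * ε))
  have ha1 := Real.smoothTransition.le_one ((Int.fract y - 4⁻¹) / (2 * ε))
  have hb0 := Real.smoothTransition.nonneg ((Int.fract y - 3 / 4) / (2 * ε))
  have hb1 := Real.smoothTransition.le_one ((Int.fract y - 3 / 4) / (2 * ε))
  rcases le_or_gt (Int.fract y) (3 / 4) with h | h
  · have hb : Real.smoothTransition ((Int.fract y - 3 / 4) / (2 * ε)) = 0 :=
      Real.smoothTransition.zero_of_nonpos (div_nonpos_of_nonpos_of_nonneg (by linarith) (by positivity))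
    rw [slopeWave, hb, abs_le]; constructor <;> nlinarith
  · have ha : Real.smoothTransition ((Int.fract y - 4⁻¹) / (2 * ε)) = 1 :=
      Real.smoothTransition.one_of_one_le (by rw [le_div_iff₀ (by positivity)]; nlinarith)
    rw [slopeWave, ha, abs_le]; constructor <;> nlinarith

/-- **`w_ε² = 1` off the corner windows** `fract⁻¹((1/4, 1/4 + 2ε) ∪ (3/4, 3/4 + 2ε))`. [folklore] -/
theorem slopeWave_sq_eq_one {ε : ℝ} (hε : 0 < ε) (hε' : ε ≤ 1 / 16) {y : ℝ}
    (h1 : Int.fract y ∉ Ioo (4⁻¹ : ℝ) (4⁻¹ + 2 * ε)) (h2 : Int.fract y ∉ Ioo (3 / 4 : ℝ) (3 / 4 + 2 * ε)) :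
    slopeWave ε y ^ 2 = 1 := by
  have hf0 : 0 ≤ Int.fract y := Int.fract_nonneg y
  have hf1 : Int.fract y < 1 := Int.fract_lt_one y
  simp only [mem_Ioo, not_and_or, not_lt] at h1 h2
  -- four plateaux
  rcases h1 with h1 | h1
  · -- `fract ≤ 1/4`: both transitions are `0`
    have ha : Real.smoothTransition ((Int.fract y - 4⁻¹) / (2 * ε)) = 0 :=
      Real.smoothTransition.zero_of_nonpos (div_nonpos_of_nonpos_of_nonneg (by linarith) (by positivity))
    have hb : Real.smoothTransition ((Int.fract y - 3 / 4) / (2 * ε)) = 0 :=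
      Real.smoothTransition.zero_of_nonpos (div_nonpos_of_nonpos_of_nonneg (by linarith) (by positivity))
    rw [slopeWave, ha, hb]; norm_num
  · have ha : Real.smoothTransition ((Int.fract y - 4⁻¹) / (2 * ε)) = 1 :=
      Real.smoothTransition.one_of_one_le (by rw [le_div_iff₀ (by positivity)]; linarith)
    rcases h2 with h2 | h2
    · have hb : Real.smoothTransition ((Int.fract y - 3 / 4) / (2 * ε)) = 0 :=
        Real.smoothTransition.zero_of_nonpos (div_nonpos_of_nonpos_of_nonneg (by linarith) (by positivity))
      rw [slopeWave, ha, hb]; norm_num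
    · have hb : Real.smoothTransition ((Int.fract y - 3 / 4) / (2 * ε)) = 1 :=
        Real.smoothTransition.one_of_one_le (by rw [le_div_iff₀ (by positivity)]; linarith)
      rw [slopeWave, ha, hb]; norm_num

/-- `0 ≤ 1 - w_ε² ≤ 1`. [folklore] -/
theorem one_sub_slopeWave_sq_mem {ε : ℝ} (hε : 0 < ε) (hε' : ε ≤ 1 / 16) (y : ℝ) :
    1 - slopeWave ε y ^ 2 ∈ Icc (0 : ℝ) 1 := by
  have h := abs_slopeWave_le hε hε' y
  have h2 : slopeWave ε y ^ 2 ≤ 1 := by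
    rw [← sq_abs]; exact pow_le_one₀ (abs_nonneg _) h
  exact ⟨by linarith, by linarith [sq_nonneg (slopeWave ε y)]⟩

/-- **The derivative of the slope wave**: at a non-integer `y` with `n = ⌊y⌋`,
`w_ε'(y) = (-ψ'((y-n-1/4)/(2ε)) + ψ'((y-n-3/4)/(2ε)))/ε`, `ψ = smoothTransition`. [folklore] -/
theorem hasDerivAt_slopeWave_of_fract_ne (ε : ℝ) {y : ℝ} (hy : Int.fract y ≠ 0) :
    HasDerivAt (slopeWave ε)
      ((-deriv Real.smoothTransition ((y - ⌊y⌋ - 4⁻¹) / (2 * ε)) +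
        deriv Real.smoothTransition ((y - ⌊y⌋ - 3 / 4) / (2 * ε))) / ε) y := by
  have hST : ∀ v, HasDerivAt Real.smoothTransition (deriv Real.smoothTransition v) v := fun v =>
    ((Real.smoothTransition.contDiff (n := 1)).contDiffAt.differentiableAt (by simp)).hasDerivAt
  have h1 : HasDerivAt (fun z : ℝ => (z - ⌊y⌋ - 4⁻¹) / (2 * ε)) (1 / (2 * ε)) y := by
    simpa using (((hasDerivAt_id y).sub_const (⌊y⌋ : ℝ)).sub_const (4⁻¹ : ℝ)).div_const (2 * ε)
  have h2 : HasDerivAt (fun z : ℝ => (z - ⌊y⌋ - 3 / 4) / (2 * ε)) (1 / (2 * ε)) y := by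
    simpa using (((hasDerivAt_id y).sub_const (⌊y⌋ : ℝ)).sub_const (3 / 4 : ℝ)).div_const (2 * ε)
  have hA := ((hST _).comp y h1).const_mul 2
  have hB := ((hST _).comp y h2).const_mul 2
  have haux : HasDerivAt (slopeWaveAux ε ⌊y⌋)
      ((-deriv Real.smoothTransition ((y - ⌊y⌋ - 4⁻¹) / (2 * ε)) +
        deriv Real.smoothTransition ((y - ⌊y⌋ - 3 / 4) / (2 * ε))) / ε) y := by
    refine HasDerivAt.congr_deriv ((hA.const_sub 1).add hB) ?_
    ring
  exact haux.congr_of_eventuallyEq (slopeWave_eventuallyEq_aux hy)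

/-- At the integers the slope wave has derivative `0`. [folklore] -/
theorem hasDerivAt_slopeWave_of_fract_eq {ε : ℝ} (hε : 0 < ε) (hε' : ε ≤ 1 / 16) {y : ℝ} (hy : Int.fract y = 0) :
    HasDerivAt (slopeWave ε) 0 y :=
  (hasDerivAt_const y (1 : ℝ)).congr_of_eventuallyEq (slopeWave_eventuallyEq_one hε hε' hy)

/-- **Uniform bound of the derivative of the slope wave**: `|w_ε'| ≤ 2 C_ψ / ε`. [folklore] -/
theorem abs_deriv_slopeWave_le {ε : ℝ} (hε : 0 < ε) (hε' : ε ≤ 1 / 16) (y : ℝ) :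
    |deriv (slopeWave ε) y| ≤ 2 * ShearCascade.Cψ1 / ε := by
  obtain ⟨hC0, hC⟩ := ShearCascade.Cψ1_spec
  by_cases hy : Int.fract y = 0
  · rw [(hasDerivAt_slopeWave_of_fract_eq hε hε' hy).deriv, abs_zero]; positivity
  · rw [(hasDerivAt_slopeWave_of_fract_ne ε hy).deriv, abs_div, abs_of_pos hε]
    refine div_le_div_of_nonneg_right ?_ hε.le
    have h1 := hC ((y - ⌊y⌋ - 4⁻¹) / (2 * ε))
    have h2 := hC ((y - ⌊y⌋ - 3 / 4) / (2 * ε))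
    have h3 := abs_add_le (-deriv Real.smoothTransition ((y - ⌊y⌋ - 4⁻¹) / (2 * ε)))
      (deriv Real.smoothTransition ((y - ⌊y⌋ - 3 / 4) / (2 * ε)))
    rw [abs_neg] at h3
    linarith

/-- **The derivative of the slope wave vanishes off the closed corner windows.** [folklore] -/
theorem deriv_slopeWave_eq_zero {ε : ℝ} (hε : 0 < ε) (hε' : ε ≤ 1 / 16) {y : ℝ}
    (h1 : Int.fract y ∉ Icc (4⁻¹ : ℝ) (4⁻¹ + 2 * ε)) (h2 : Int.fract y ∉ Icc (3 / 4 : ℝ) (3 / 4 + 2 * ε)) :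
    deriv (slopeWave ε) y = 0 := by
  by_cases hy : Int.fract y = 0
  · exact (hasDerivAt_slopeWave_of_fract_eq hε hε' hy).deriv
  rw [(hasDerivAt_slopeWave_of_fract_ne ε hy).deriv]
  -- `ψ'` vanishes outside `[0, 1]`
  have hvan : ∀ v : ℝ, v ∉ Icc (0 : ℝ) 1 → deriv Real.smoothTransition v = 0 := by
    intro v hv
    rw [mem_Icc, not_and_or, not_le, not_le] at hv
    rcases hv with h | h
    · refine IsLocalMin.deriv_eq_zero ?_
      filter_upwards [Iio_mem_nhds h] with s hs
      rw [Real.smoothTransition.zero_of_nonpos (le_of_lt hs), Real.smoothTransition.zero_of_nonpos h.le]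
    · refine IsLocalMax.deriv_eq_zero ?_
      filter_upwards [Ioi_mem_nhds h] with s hs
      rw [Real.smoothTransition.one_of_one_le (le_of_lt hs), Real.smoothTransition.one_of_one_le h.le]
  have hfr : y - ⌊y⌋ = Int.fract y := rfl
  simp only [mem_Icc, not_and_or, not_le] at h1 h2
  have e1 : deriv Real.smoothTransition ((y - ⌊y⌋ - 4⁻¹) / (2 * ε)) = 0 := by
    refine hvan _ ?_
    simp only [mem_Icc, not_and_or, not_le]
    rcases h1 with h | h
    · left; rw [div_lt_iff₀ (by positivity), hfr]; linarith
    · right; rw [lt_div_iff₀ (by positivity), hfr]; linarith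
  have e2 : deriv Real.smoothTransition ((y - ⌊y⌋ - 3 / 4) / (2 * ε)) = 0 := by
    refine hvan _ ?_
    simp only [mem_Icc, not_and_or, not_le]
    rcases h2 with h | h
    · left; rw [div_lt_iff₀ (by positivity), hfr]; linarith
    · right; rw [lt_div_iff₀ (by positivity), hfr]; linarith
  rw [e1, e2]; simp

/-- **The slope wave has zero mean over a period.** On `[0,1)` it is `ψ_0`; the two transition
integrals `∫₀¹ ψ((y-1/4)/(2ε))` and `∫₀¹ ψ((y-3/4)/(2ε))` differ by a shift of `1/2`, i.e. by
`∫_{1/2}^{1} 1 - ∫_{-1/2}^{0} 0 = 1/2`. [folklore] -/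
theorem intervalIntegral_slopeWave {ε : ℝ} (hε : 0 < ε) (hε' : ε ≤ 1 / 16) :
    ∫ y in (0 : ℝ)..1, slopeWave ε y = 0 := by
  -- replace by the global representative `ψ_0` (they agree on `[0,1)`)
  have hcongr : ∫ y in (0 : ℝ)..1, slopeWave ε y = ∫ y in (0 : ℝ)..1, slopeWaveAux ε 0 y := by
    refine intervalIntegral.integral_congr_ae ?_
    have : ∀ᵐ y : ℝ, y ≠ 1 := by simp [ae_iff, measure_singleton]
    filter_upwards [this] with y hy1 hy
    rw [uIoc_of_le zero_le_one] at hy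
    have hfl : ⌊y⌋ = 0 := Int.floor_eq_iff.2 ⟨by exact_mod_cast hy.1.le, by
      push_cast; exact lt_of_le_of_ne (by linarith [hy.2]) (by simpa using hy1)⟩
    have h := slopeWave_eq_aux (ε := ε) (y := y) (z := y) rfl
    rw [hfl] at h
    exact h
  rw [hcongr]
  set g : ℝ → ℝ := fun u => Real.smoothTransition ((u - 4⁻¹) / (2 * ε)) with hg
  have hgc : Continuous g := Real.smoothTransition.continuous.comp ((continuous_id.sub continuous_const).div_const _)
  have hgi : ∀ a b : ℝ, IntervalIntegrable g volume a b := fun a b => hgc.intervalIntegrable a b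
  have e : slopeWaveAux ε 0 = fun y => 1 - 2 * g y + 2 * g (y - 2⁻¹) := by
    funext y
    simp only [slopeWaveAux, hg, Int.cast_zero, sub_zero]
    congr 3
    ring
  rw [e]
  have hI1 : ∫ y in (0 : ℝ)..1, g (y - 2⁻¹) = ∫ y in (-2⁻¹ : ℝ)..2⁻¹, g y := by
    rw [intervalIntegral.integral_comp_sub_right g 2⁻¹]; norm_num
  -- `∫₀¹ g - ∫_{-1/2}^{1/2} g = ∫_{1/2}^{1} g - ∫_{-1/2}^{0} g = 1/2 - 0`
  have hsplit1 : ∫ y in (0 : ℝ)..1, g y = (∫ y in (0 : ℝ)..2⁻¹, g y) + ∫ y in (2⁻¹ : ℝ)..1, g y :=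
    (intervalIntegral.integral_add_adjacent_intervals (hgi _ _) (hgi _ _)).symm
  have hsplit2 : ∫ y in (-2⁻¹ : ℝ)..2⁻¹, g y = (∫ y in (-2⁻¹ : ℝ)..0, g y) + ∫ y in (0 : ℝ)..2⁻¹, g y :=
    (intervalIntegral.integral_add_adjacent_intervals (hgi _ _) (hgi _ _)).symm
  have hone : ∫ y in (2⁻¹ : ℝ)..1, g y = 2⁻¹ := by
    have h : ∫ y in (2⁻¹ : ℝ)..1, g y = ∫ y in (2⁻¹ : ℝ)..1, (1 : ℝ) := by
      refine intervalIntegral.integral_congr fun y hy => ?_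
      rw [uIcc_of_le (by norm_num)] at hy
      simp only [hg]
      exact Real.smoothTransition.one_of_one_le (by rw [le_div_iff₀ (by positivity)]; nlinarith [hy.1])
    rw [h, integral_one]; norm_num
  have hzero : ∫ y in (-2⁻¹ : ℝ)..0, g y = 0 := by
    have h : ∫ y in (-2⁻¹ : ℝ)..0, g y = ∫ y in (-2⁻¹ : ℝ)..0, (0 : ℝ) := by
      refine intervalIntegral.integral_congr fun y hy => ?_
      rw [uIcc_of_le (by norm_num)] at hy
      simp only [hg]
      exact Real.smoothTransition.zero_of_nonpos (div_nonpos_of_nonpos_of_nonneg (by linarith [hy.2]) (by positivity))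
    rw [h, intervalIntegral.integral_zero]
  have hi1 : IntervalIntegrable (fun y => 1 - 2 * g y) volume 0 1 :=
    (intervalIntegrable_const.sub ((hgi 0 1).const_mul 2))
  have hi2 : IntervalIntegrable (fun y => 2 * g (y - 2⁻¹)) volume 0 1 :=
    ((hgc.comp (continuous_id.sub continuous_const)).intervalIntegrable 0 1).const_mul 2
  rw [intervalIntegral.integral_add hi1 hi2, intervalIntegral.integral_sub intervalIntegrable_const ((hgi 0 1).const_mul 2),
    intervalIntegral.integral_const_mul, intervalIntegral.integral_const_mul, hI1, hsplit1, hsplit2, hone, hzero,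
    integral_one]
  ring

/-- **The mean defect `∫₀¹ (1 - w_ε²) ≤ 4ε`** (the integrand vanishes off the two corner windows
of length `2ε` and is at most `1`). [folklore] -/
theorem intervalIntegral_one_sub_slopeWave_sq_le {ε : ℝ} (hε : 0 < ε) (hε' : ε ≤ 1 / 16) :
    ∫ y in (0 : ℝ)..1, (1 - slopeWave ε y ^ 2) ≤ 4 * ε := by
  set F : ℝ → ℝ := fun y => 1 - slopeWave ε y ^ 2 with hF
  have hFc : Continuous F := continuous_const.sub ((continuous_slopeWave hε hε').pow 2)
  have hFi : ∀ a b : ℝ, IntervalIntegrable F volume a b := fun a b => hFc.intervalIntegrable a b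
  have hF01 : ∀ y, F y ∈ Icc (0 : ℝ) 1 := fun y => one_sub_slopeWave_sq_mem hε hε' y
  -- the integrand vanishes at `y ∈ [0,1)` off the windows
  have hvan : ∀ y ∈ Ico (0 : ℝ) 1, y ∉ Ioo (4⁻¹ : ℝ) (4⁻¹ + 2 * ε) → y ∉ Ioo (3 / 4 : ℝ) (3 / 4 + 2 * ε) → F y = 0 := by
    intro y hy h1 h2
    have hfr : Int.fract y = y := Int.fract_eq_self.2 hy
    simp only [hF]
    rw [slopeWave_sq_eq_one hε hε' (by rwa [hfr]) (by rwa [hfr]), sub_self]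
  -- split `[0,1]` at `1/4, 1/4 + 2ε, 3/4, 3/4 + 2ε`
  have hs : ∫ y in (0 : ℝ)..1, F y =
      (∫ y in (0 : ℝ)..4⁻¹, F y) + (∫ y in (4⁻¹ : ℝ)..(4⁻¹ + 2 * ε), F y) +
        (∫ y in (4⁻¹ + 2 * ε : ℝ)..(3 / 4), F y) + (∫ y in (3 / 4 : ℝ)..(3 / 4 + 2 * ε), F y) +
        ∫ y in (3 / 4 + 2 * ε : ℝ)..1, F y := by
    rw [intervalIntegral.integral_add_adjacent_intervals (hFi _ _) (hFi _ _),
      intervalIntegral.integral_add_adjacent_intervals (hFi _ _) (hFi _ _),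
      intervalIntegral.integral_add_adjacent_intervals (hFi _ _) (hFi _ _),
      intervalIntegral.integral_add_adjacent_intervals (hFi _ _) (hFi _ _)]
  have hz1 : ∫ y in (0 : ℝ)..4⁻¹, F y = 0 := by
    have h : ∫ y in (0 : ℝ)..4⁻¹, F y = ∫ y in (0 : ℝ)..4⁻¹, (0 : ℝ) := by
      refine intervalIntegral.integral_congr fun y hy => ?_
      rw [uIcc_of_le (by norm_num)] at hy
      exact hvan y ⟨hy.1, by linarith [hy.2]⟩ (fun h => by linarith [h.1, hy.2]) (fun h => by linarith [h.1, hy.2])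
    rw [h, intervalIntegral.integral_zero]
  have hz2 : ∫ y in (4⁻¹ + 2 * ε : ℝ)..(3 / 4), F y = 0 := by
    have h : ∫ y in (4⁻¹ + 2 * ε : ℝ)..(3 / 4), F y = ∫ y in (4⁻¹ + 2 * ε : ℝ)..(3 / 4), (0 : ℝ) := by
      refine intervalIntegral.integral_congr fun y hy => ?_
      rw [uIcc_of_le (by linarith)] at hy
      exact hvan y ⟨by linarith [hy.1], by linarith [hy.2]⟩ (fun h => by linarith [h.2, hy.1])
        (fun h => by linarith [h.1, hy.2])
    rw [h, intervalIntegral.integral_zero]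
  have hz3 : ∫ y in (3 / 4 + 2 * ε : ℝ)..1, F y = 0 := by
    have h : ∫ y in (3 / 4 + 2 * ε : ℝ)..1, F y = ∫ y in (3 / 4 + 2 * ε : ℝ)..1, (0 : ℝ) := by
      refine intervalIntegral.integral_congr_ae ?_
      have : ∀ᵐ y : ℝ, y ≠ 1 := by simp [ae_iff, measure_singleton]
      filter_upwards [this] with y hy1 hy
      rw [uIoc_of_le (by linarith)] at hy
      exact hvan y ⟨by linarith [hy.1], lt_of_le_of_ne hy.2 hy1⟩ (fun h => by linarith [h.2, hy.1])
        (fun h => by linarith [h.2, hy.1])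
    rw [h, intervalIntegral.integral_zero]
  have hb1 : ∫ y in (4⁻¹ : ℝ)..(4⁻¹ + 2 * ε), F y ≤ 2 * ε := by
    have h := intervalIntegral.integral_mono_on (μ := volume) (a := (4⁻¹ : ℝ)) (b := 4⁻¹ + 2 * ε) (f := F)
      (g := fun _ => (1 : ℝ)) (by linarith) (hFi _ _) intervalIntegrable_const (fun y _ => (hF01 y).2)
    rw [intervalIntegral.integral_const, smul_eq_mul, mul_one] at h
    linarith
  have hb2 : ∫ y in (3 / 4 : ℝ)..(3 / 4 + 2 * ε), F y ≤ 2 * ε := by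
    have h := intervalIntegral.integral_mono_on (μ := volume) (a := (3 / 4 : ℝ)) (b := 3 / 4 + 2 * ε) (f := F)
      (g := fun _ => (1 : ℝ)) (by linarith) (hFi _ _) intervalIntegrable_const (fun y _ => (hF01 y).2)
    rw [intervalIntegral.integral_const, smul_eq_mul, mul_one] at h
    linarith
  rw [hs, hz1, hz2, hz3]
  linarith

/-- **`∫₀¹ (w_ε')² ≤ 16 C_ψ² / ε`** (the derivative vanishes off the closed corner windows, of
total length `4ε`, and is bounded by `2C_ψ/ε`). [folklore] -/
theorem intervalIntegral_deriv_slopeWave_sq_le {ε : ℝ} (hε : 0 < ε) (hε' : ε ≤ 1 / 16) :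
    ∫ y in (0 : ℝ)..1, deriv (slopeWave ε) y ^ 2 ≤ 16 * ShearCascade.Cψ1 ^ 2 / ε := by
  obtain ⟨hC0, hC⟩ := ShearCascade.Cψ1_spec
  set F : ℝ → ℝ := fun y => deriv (slopeWave ε) y ^ 2 with hF
  have hFc : Continuous F := ((contDiff_slopeWave hε hε').continuous_deriv (by simp)).pow 2
  have hFi : ∀ a b : ℝ, IntervalIntegrable F volume a b := fun a b => hFc.intervalIntegrable a b
  have hFle : ∀ y, F y ≤ (2 * ShearCascade.Cψ1 / ε) ^ 2 := fun y => by
    simp only [hF]; rw [← sq_abs]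
    exact pow_le_pow_left₀ (abs_nonneg _) (abs_deriv_slopeWave_le hε hε' y) 2
  have hvan : ∀ y ∈ Ico (0 : ℝ) 1, y ∉ Icc (4⁻¹ : ℝ) (4⁻¹ + 2 * ε) → y ∉ Icc (3 / 4 : ℝ) (3 / 4 + 2 * ε) → F y = 0 := by
    intro y hy h1 h2
    have hfr : Int.fract y = y := Int.fract_eq_self.2 hy
    simp only [hF]
    rw [deriv_slopeWave_eq_zero hε hε' (by rwa [hfr]) (by rwa [hfr])]; simp
  have hs : ∫ y in (0 : ℝ)..1, F y =
      (∫ y in (0 : ℝ)..4⁻¹, F y) + (∫ y in (4⁻¹ : ℝ)..(4⁻¹ + 2 * ε), F y) +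
        (∫ y in (4⁻¹ + 2 * ε : ℝ)..(3 / 4), F y) + (∫ y in (3 / 4 : ℝ)..(3 / 4 + 2 * ε), F y) +
        ∫ y in (3 / 4 + 2 * ε : ℝ)..1, F y := by
    rw [intervalIntegral.integral_add_adjacent_intervals (hFi _ _) (hFi _ _),
      intervalIntegral.integral_add_adjacent_intervals (hFi _ _) (hFi _ _),
      intervalIntegral.integral_add_adjacent_intervals (hFi _ _) (hFi _ _),
      intervalIntegral.integral_add_adjacent_intervals (hFi _ _) (hFi _ _)]
  -- off the (closed) windows the integrand vanishes a.e.
  have hz1 : ∫ y in (0 : ℝ)..4⁻¹, F y = 0 := by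
    have h : ∫ y in (0 : ℝ)..4⁻¹, F y = ∫ y in (0 : ℝ)..4⁻¹, (0 : ℝ) := by
      refine intervalIntegral.integral_congr_ae ?_
      have : ∀ᵐ y : ℝ, y ≠ 4⁻¹ := by simp [ae_iff, measure_singleton]
      filter_upwards [this] with y hy1 hy
      rw [uIoc_of_le (by norm_num)] at hy
      exact hvan y ⟨hy.1.le, by linarith [hy.2]⟩ (fun h => hy1 (le_antisymm hy.2 h.1)) (fun h => by linarith [h.1, hy.2])
    rw [h, intervalIntegral.integral_zero]
  have hz2 : ∫ y in (4⁻¹ + 2 * ε : ℝ)..(3 / 4), F y = 0 := by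
    have h : ∫ y in (4⁻¹ + 2 * ε : ℝ)..(3 / 4), F y = ∫ y in (4⁻¹ + 2 * ε : ℝ)..(3 / 4), (0 : ℝ) := by
      refine intervalIntegral.integral_congr_ae ?_
      have : ∀ᵐ y : ℝ, y ≠ 3 / 4 := by simp [ae_iff, measure_singleton]
      filter_upwards [this] with y hy1 hy
      rw [uIoc_of_le (by linarith)] at hy
      exact hvan y ⟨by linarith [hy.1], by linarith [hy.2]⟩ (fun h => by linarith [h.2, hy.1])
        (fun h => hy1 (le_antisymm hy.2 h.1))
    rw [h, intervalIntegral.integral_zero]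
  have hz3 : ∫ y in (3 / 4 + 2 * ε : ℝ)..1, F y = 0 := by
    have h : ∫ y in (3 / 4 + 2 * ε : ℝ)..1, F y = ∫ y in (3 / 4 + 2 * ε : ℝ)..1, (0 : ℝ) := by
      refine intervalIntegral.integral_congr_ae ?_
      have : ∀ᵐ y : ℝ, y ≠ 1 := by simp [ae_iff, measure_singleton]
      filter_upwards [this] with y hy1 hy
      rw [uIoc_of_le (by linarith)] at hy
      exact hvan y ⟨by linarith [hy.1], lt_of_le_of_ne hy.2 hy1⟩ (fun h => by linarith [h.2, hy.1])
        (fun h => by linarith [h.2, hy.1])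
    rw [h, intervalIntegral.integral_zero]
  have hb1 : ∫ y in (4⁻¹ : ℝ)..(4⁻¹ + 2 * ε), F y ≤ 2 * ε * (2 * ShearCascade.Cψ1 / ε) ^ 2 := by
    have h := intervalIntegral.integral_mono_on (μ := volume) (a := (4⁻¹ : ℝ)) (b := 4⁻¹ + 2 * ε) (f := F)
      (g := fun _ => (2 * ShearCascade.Cψ1 / ε) ^ 2) (by linarith) (hFi _ _) intervalIntegrable_const
      (fun y _ => hFle y)
    rw [intervalIntegral.integral_const, smul_eq_mul] at h
    linarith
  have hb2 : ∫ y in (3 / 4 : ℝ)..(3 / 4 + 2 * ε), F y ≤ 2 * ε * (2 * ShearCascade.Cψ1 / ε) ^ 2 := by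
    have h := intervalIntegral.integral_mono_on (μ := volume) (a := (3 / 4 : ℝ)) (b := 3 / 4 + 2 * ε) (f := F)
      (g := fun _ => (2 * ShearCascade.Cψ1 / ε) ^ 2) (by linarith) (hFi _ _) intervalIntegrable_const
      (fun y _ => hFle y)
    rw [intervalIntegral.integral_const, smul_eq_mul] at h
    linarith
  have e : 2 * ε * (2 * ShearCascade.Cψ1 / ε) ^ 2 + 2 * ε * (2 * ShearCascade.Cψ1 / ε) ^ 2 = 16 * ShearCascade.Cψ1 ^ 2 / ε := by
    field_simp; ring
  rw [hs, hz1, hz2, hz3]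
  linarith

/-! ### The primitive `S_ε` -/

/-- **The smoothed triangle wave** `S_ε(y) = ∫₀ʸ w_ε`. [folklore] -/
def sawS (ε y : ℝ) : ℝ := ∫ t in (0 : ℝ)..y, slopeWave ε t

/-- `S_ε' = w_ε`. [folklore] -/
theorem hasDerivAt_sawS {ε : ℝ} (hε : 0 < ε) (hε' : ε ≤ 1 / 16) (y : ℝ) :
    HasDerivAt (sawS ε) (slopeWave ε y) y :=
  ((continuous_slopeWave hε hε').integral_hasStrictDerivAt 0 y).hasDerivAt

/-- `deriv S_ε = w_ε`. [folklore] -/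
theorem deriv_sawS {ε : ℝ} (hε : 0 < ε) (hε' : ε ≤ 1 / 16) : deriv (sawS ε) = slopeWave ε :=
  funext fun y => (hasDerivAt_sawS hε hε' y).deriv

/-- `S_ε` is smooth. [folklore] -/
theorem contDiff_sawS {ε : ℝ} (hε : 0 < ε) (hε' : ε ≤ 1 / 16) : ContDiff ℝ ∞ (sawS ε) := by
  rw [contDiff_infty_iff_deriv, deriv_sawS hε hε']
  exact ⟨fun y => (hasDerivAt_sawS hε hε' y).differentiableAt, contDiff_slopeWave hε hε'⟩

/-- `S_ε` is `1`-periodic (the slope wave has zero mean). [folklore] -/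
theorem sawS_periodic {ε : ℝ} (hε : 0 < ε) (hε' : ε ≤ 1 / 16) : Function.Periodic (sawS ε) 1 := by
  intro y
  have hi : ∀ a b : ℝ, IntervalIntegrable (slopeWave ε) volume a b := fun a b =>
    (continuous_slopeWave hε hε').intervalIntegrable a b
  unfold sawS
  rw [← intervalIntegral.integral_add_adjacent_intervals (hi 0 y) (hi y (y + 1)),
    (slopeWave_periodic ε).intervalIntegral_add_eq y 0, zero_add, intervalIntegral_slopeWave hε hε', add_zero]

/-- **`|S_ε| ≤ 1`** (reduce to `[0,1)` by periodicity; `|w_ε| ≤ 1`). [folklore] -/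
theorem abs_sawS_le {ε : ℝ} (hε : 0 < ε) (hε' : ε ≤ 1 / 16) (y : ℝ) : |sawS ε y| ≤ 1 := by
  have hred : sawS ε y = sawS ε (Int.fract y) := by
    rw [Int.fract, show y - (⌊y⌋ : ℝ) = y - (⌊y⌋ : ℤ) * (1 : ℝ) by ring, (sawS_periodic hε hε').sub_int_mul_eq]
  rw [hred, sawS]
  have h := intervalIntegral.norm_integral_le_of_norm_le_const (a := (0 : ℝ)) (b := Int.fract y) (C := 1)
    (f := slopeWave ε) (fun t _ => by rw [Real.norm_eq_abs]; exact abs_slopeWave_le hε hε' t)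
  rw [Real.norm_eq_abs, sub_zero, abs_of_nonneg (Int.fract_nonneg y)] at h
  exact h.trans (by linarith [Int.fract_lt_one y])

/-! ### The stage profile `y ↦ c S_ε(N y + ϑ)` -/

/-- **The stage profile** `y ↦ c · S_ε(N y + ϑ)` (amplitude `c`, integer frequency `N`, phase
`ϑ`) as a smooth `1`-periodic shear profile. [folklore] -/
def stageProfile (ε : ℝ) (hε : 0 < ε) (hε' : ε ≤ 1 / 16) (N : ℕ) (c ϑ : ℝ) : ShearProfile where
  toFun := fun y => c * sawS ε (N * y + ϑ)
  periodic' := fun y => by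
    simp only
    rw [show (N : ℝ) * (y + 1) + ϑ = (N * y + ϑ) + (N : ℕ) * (1 : ℝ) by ring,
      (sawS_periodic hε hε').nat_mul N]
  contDiff' := contDiff_const.mul ((contDiff_sawS hε hε').comp
    ((contDiff_const.mul contDiff_id).add contDiff_const))

/-- Values of the stage profile. [folklore] -/
@[simp]
theorem stageProfile_apply {ε : ℝ} (hε : 0 < ε) (hε' : ε ≤ 1 / 16) (N : ℕ) (c ϑ y : ℝ) :
    stageProfile ε hε hε' N c ϑ y = c * sawS ε (N * y + ϑ) := rfl

/-- `|c S_ε(N y + ϑ)| ≤ |c|`. [folklore] -/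
theorem abs_stageProfile_le {ε : ℝ} (hε : 0 < ε) (hε' : ε ≤ 1 / 16) (N : ℕ) (c ϑ y : ℝ) :
    |stageProfile ε hε hε' N c ϑ y| ≤ |c| := by
  rw [stageProfile_apply, abs_mul]
  exact mul_le_of_le_one_right (abs_nonneg _) (abs_sawS_le hε hε' _)

/-- **The derivative of the stage profile**: `(c S_ε(N y + ϑ))' = c N w_ε(N y + ϑ)`. [folklore] -/
theorem hasDerivAt_stageProfile {ε : ℝ} (hε : 0 < ε) (hε' : ε ≤ 1 / 16) (N : ℕ) (c ϑ y : ℝ) :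
    HasDerivAt (stageProfile ε hε hε' N c ϑ) (c * (N * slopeWave ε (N * y + ϑ))) y := by
  have h1 : HasDerivAt (fun y : ℝ => (N : ℝ) * y + ϑ) N y := by
    simpa using ((hasDerivAt_id y).const_mul (N : ℝ)).add_const ϑ
  have h2 := (hasDerivAt_sawS hε hε' (N * y + ϑ)).comp y h1
  have h3 := h2.const_mul c
  rw [show c * (N * slopeWave ε (N * y + ϑ)) = c * (slopeWave ε (N * y + ϑ) * N) by ring]
  exact h3

/-- `deriv` of the stage profile. [folklore] -/
theorem deriv_stageProfile {ε : ℝ} (hε : 0 < ε) (hε' : ε ≤ 1 / 16) (N : ℕ) (c ϑ : ℝ) :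
    deriv (stageProfile ε hε hε' N c ϑ) = fun y => c * (N * slopeWave ε (N * y + ϑ)) :=
  funext fun y => (hasDerivAt_stageProfile hε hε' N c ϑ y).deriv

/-- **The second derivative of the stage profile**: `c N² w_ε'(N y + ϑ)`. [folklore] -/
theorem hasDerivAt_deriv_stageProfile {ε : ℝ} (hε : 0 < ε) (hε' : ε ≤ 1 / 16) (N : ℕ) (c ϑ y : ℝ) :
    HasDerivAt (deriv (stageProfile ε hε hε' N c ϑ)) (c * (N * (N * deriv (slopeWave ε) (N * y + ϑ)))) y := by
  rw [deriv_stageProfile hε hε' N c ϑ]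
  have h1 : HasDerivAt (fun y : ℝ => (N : ℝ) * y + ϑ) N y := by
    simpa using ((hasDerivAt_id y).const_mul (N : ℝ)).add_const ϑ
  have hd : HasDerivAt (slopeWave ε) (deriv (slopeWave ε) (N * y + ϑ)) (N * y + ϑ) :=
    ((contDiff_slopeWave hε hε').differentiable (by simp)).differentiableAt.hasDerivAt
  have h2 := hd.comp y h1
  have h3 := (h2.const_mul (N : ℝ)).const_mul c
  rw [show c * (N * (N * deriv (slopeWave ε) (N * y + ϑ))) = c * (N * (deriv (slopeWave ε) (N * y + ϑ) * N)) by ring]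
  exact h3

/-- `deriv (deriv ·)` of the stage profile. [folklore] -/
theorem deriv_deriv_stageProfile {ε : ℝ} (hε : 0 < ε) (hε' : ε ≤ 1 / 16) (N : ℕ) (c ϑ : ℝ) :
    deriv (deriv (stageProfile ε hε hε' N c ϑ)) = fun y => c * (N * (N * deriv (slopeWave ε) (N * y + ϑ))) :=
  funext fun y => (hasDerivAt_deriv_stageProfile hε hε' N c ϑ y).deriv

/-- **Slope bound of the stage profile**: `|(c S_ε(N· + ϑ))'| ≤ |c| N`. [folklore] -/
theorem abs_deriv_stageProfile_le {ε : ℝ} (hε : 0 < ε) (hε' : ε ≤ 1 / 16) (N : ℕ) (c ϑ y : ℝ) :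
    |deriv (stageProfile ε hε hε' N c ϑ) y| ≤ |c| * N := by
  rw [deriv_stageProfile hε hε', abs_mul, abs_mul, Nat.abs_cast]
  refine mul_le_mul_of_nonneg_left ?_ (abs_nonneg _)
  exact mul_le_of_le_one_right (Nat.cast_nonneg _) (abs_slopeWave_le hε hε' _)

/-- **Curvature bound of the stage profile**: `|(c S_ε(N· + ϑ))''| ≤ |c| N² (2C_ψ/ε)`. [folklore] -/
theorem abs_deriv_deriv_stageProfile_le {ε : ℝ} (hε : 0 < ε) (hε' : ε ≤ 1 / 16) (N : ℕ) (c ϑ y : ℝ) :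
    |deriv (deriv (stageProfile ε hε hε' N c ϑ)) y| ≤ |c| * N ^ 2 * (2 * ShearCascade.Cψ1 / ε) := by
  rw [deriv_deriv_stageProfile hε hε', abs_mul, abs_mul, abs_mul, Nat.abs_cast]
  have h := abs_deriv_slopeWave_le hε hε' (N * y + ϑ)
  have hN : (0 : ℝ) ≤ N := Nat.cast_nonneg _
  calc |c| * (N * (N * |deriv (slopeWave ε) (N * y + ϑ)|)) ≤ |c| * (N * (N * (2 * ShearCascade.Cψ1 / ε))) := by
        gcongr
    _ = |c| * N ^ 2 * (2 * ShearCascade.Cψ1 / ε) := by ring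

end Profiles

end DEIJ

end Torus

end Literature.Analysis.FluidPDE

end
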